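import Literature.Barriers.RiemannHypothesis.EpsteinZetaRealZerosNearOne
import Literature.NumberTheory.LFunctions.SiegelAbelSummation
import Literature.NumberTheory.QuadraticFields.ClassNumberOneSmallRange
import Literature.NumberTheory.QuadraticFields.HeckeLandauThetaBound
import HarnessLib

/-!
# Hecke–Landau made explicit (Oesterlé 1988, II §3): if `ζ_{ℚ(√−d)}` has no real zero in
# `(1 − 2/log d, 1)` then `h(−d) ≥ (2/(πe)) √d / log d`

Topic `NumberTheory/QuadraticFields`, namespace `Literature.NumberTheory.QuadraticFields.HeckeLandau`.
Everything here is PROVED (theorems only; no definitions, no named facts).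

J. Oesterlé, *Le problème de Gauss sur le nombre de classes*, Enseign. Math. (2) 34 (1988) 43–67,
II §3, Proposition p. 58 («en suivant une démonstration de Hecke, publiée par Landau (1918)»):

> «Si la fonction zêta `ζ_K` du corps `K = ℚ + ℚ i√d` n'admet aucun zéro réel `> 1 − (2/log d)`,
> on a `h(−d) ≥ (2/(πe)) √d / log d`.» (28)

with the printed proof (p. 58): for `α ∈ ]½, 1[` such that `ζ_K` does not vanish on `]α, 1[` one has
`ζ_K(α) ≤ 0`, i.e. `Σ_{C ∈ Cl(−d)} Λ(C, α) ≤ 0` (formula (23), `ζ_K = Σ_C ζ(C, ·)`), while by the theta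
integral (22) `Λ(C, α) + (α(1 − α))⁻¹` is positive for every class `C` and is
`≥ 2∫₁^∞ e^{−2πt/√d}(t^{α−1} + t^{−α}) dt` for the neutral class; hence
`h(−d) ≥ 2α(1 − α) ∫₁^∞ e^{−2πt/√d}(t^{α−1} + t^{−α}) dt`, and one takes `α = 1 − 2/log d`.

This file proves the argument VERBATIM on the tree's Epstein machinery
(`Literature/Barriers/RiemannHypothesis/EpsteinZetaCentralValue.lean`, `…NearOne.lean`): Oesterlé's
`Λ(C, s) + 1/s + 1/(1 − s)` is `Λ₀` of the theta pair `thetaFEPair z_C` of the Heegner point of the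
(swapped) reduced form of `C` (Riemann's integral), his (23) is the class sum
`ζ(s)L(s, χ) = ½ Σ_{Q reduced} Z_Q(s)` (`riemannZeta_mul_LFunction_eq_half_sum_of_one_lt_re`,
continued to `ℂ ∖ {1}`), and `h(−d)` is the number of reduced primitive forms of discriminant `−d`
(`BinaryQuadraticForm.classNumber`; `= h_K` by `Quadratic.card_reducedForms_eq_classNumber`).

* `re_Λ₀_eq_integral_Ioi_one` — Oesterlé's (22) on the real axis:
  `Λ₀,z(σ) = ∫₁^∞ (Θ_z(t) − 1)(t^{σ−1} + t^{−σ}) dt`;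
* `re_Λ₀_ge` — the neutral-class minorant `Λ₀,z(σ) ≥ 2∫₁^∞ e^{−πt/y}(t^{σ−1} + t^{−σ}) dt`, `y = Im z`
  (the theta terms `(0, ±1)`);
* `classNumber_ge_integral` — **`h(−d) ≥ 2α(1−α)∫₁^∞ e^{−2πt/√d}(t^{α−1} + t^{−α}) dt`** whenever
  `L(s, χ_{−d})` has no real zero in `(α, 1)` (`0 < α < 1`), for the odd real primitive character
  `χ` mod `d > 4` — the displayed inequality of p. 58;
* `classNumber_ge_closedForm` — with `α = 1 − 2/log d` (`δ = 2/log d`, `R = (2/(πe))√d/log d`):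
  `h(−d) ≥ R(1−δ)(2π)^δΓ(1−δ) − 2δ + 2(1−δ)((2π)^{−δ} − e^{−1})` (`d ≥ 40`), from the elementary
  bounds `∫₁^∞ e^{−ct}t^{α−1} dt ≥ c^{−α}Γ(α) − 1/α`, `∫₁^∞ e^{−ct}t^{−α} dt ≥ e^{−1}(c^{α−1} − 1)/(1−α)`
  (`c = 2π/√d ≤ 1`) and `(√d)^{δ} = e`;
* `classNumber_ge_oesterle` — **the Proposition as printed, (28): `h(−d) ≥ (2/(πe))√d/log d`** for
  every `d > 4` carrying an odd real primitive character without real zeros of `L(s, χ)` in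
  `(1 − 2/log d, 1)`: for `d ≥ 1809` by three numerical bands (`bandA`, `bandB`, `bandC`, with
  `Γ(1−δ) ≥ 1` by convexity and the constants `(2π)^{±1/4}`, `(2π)^{±2/9}`, `(2π)^{−4/15}`, `e^{−1}`),
  for `201 ≤ d ≤ 1808` by `h(−d) ≥ 2 ≥ R` (explicit non-principal reduced forms,
  `two_le_classNumber_of_fundamental`), for `d ≤ 200` by `h(−d) ≥ 1 ≥ R` — where Oesterlé appeals
  to the class-number tables for `d < 15000`.

* `lt_four_million_of_classNumber_le_thirty` — Oesterlé's remark (2) p. 59 made explicit: under the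
  same real-zero hypothesis, `h(−d) ≤ 30 ⇒ d < 4·10⁶` (the range of Buell's 1977 table).
* `oesterleBound_le_one` / `_le_two` / `_le_three` — the printed sentence after (28): the right-hand
  side is `≤ 1` for `d < 800`, `≤ 2` for `d ≤ 5000`, `≤ 3` for `d ≤ 15000` (here for real `d ≥ 3`, by
  the monotonicity of `√x/log x` past `e²` and endpoint numerics).

Not used: the class number one theorem, GRH, any numerical integration. The hypothesis is the
absence of real zeros of `L(s, χ)` only on `(1 − 2/log d, 1)` (a finite, certifiable statement for
each `d`), which is what makes the Proposition a «GRH ⇒ effective `h(−d) ≫ √d/log d`» in the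
explicit form used for Oesterlé's remark p. 59 (under GRH all `−d` with `h(−d) ≤ 30` are in Buell's
table).

## References

* [Oesterle1988Gauss] J. Oesterlé, *Le problème de Gauss sur le nombre de classes*, Enseign. Math.
  (2) 34 (1988), 43–67, II §3 Proposition, p. 58 (28) and its proof pp. 58–59; formulas (22)–(23)
  pp. 55–56.
* E. Landau, *Über die Klassenzahl imaginär-quadratischer Zahlkörper*, Gött. Nachr. (1918), 285–295
  (Hecke's theorem, cited by Oesterlé p. 58 footnote 1).
-/

noncomputable section

open Complex Filter Topology MeasureTheory Set
open scoped UpperHalfPlane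

namespace Literature.NumberTheory.QuadraticFields.HeckeLandau

open Literature.Barriers.RiemannHypothesis
open Literature.NumberTheory.Automorphic
open Literature.NumberTheory.QuadraticFields.BinaryQuadraticForm (reducedForms mem_reducedForms_iff
  le_of_isReduced discr_apply principalForm principalForm_mem_reducedForms principalForm_fst classNumber)

/-! ## The theta terms `(0, ±1)`: `Θ_z(t) ≥ 1 + 2e^{−πt/y}` -/

/-- `Θ_z(t) ≥ 1 + 2e^{−πt/y}` (`y = Im z`, `t > 0`): the tree's
`HeckeLandau.one_add_two_mul_exp_le_thetaQ` (file `HeckeLandauThetaBound`), re-bracketed. [folklore] -/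
private theorem one_add_two_exp_le_thetaQ (z : ℍ) {t : ℝ} (ht : 0 < t) :
    1 + 2 * Real.exp (-(Real.pi * t / z.im)) ≤ thetaQ z t := by
  have h := one_add_two_mul_exp_le_thetaQ z ht
  rwa [show -Real.pi * t / z.im = -(Real.pi * t / z.im) by ring] at h

/-- On `(1, ∞)`: `Re f̃(t) = Θ_z(t) − 1 ≥ 2e^{−πt/y}`. [folklore] -/
private theorem two_mul_exp_le_re_f_modif (z : ℍ) {t : ℝ} (ht : 1 < t) :
    2 * Real.exp (-(Real.pi * t / z.im)) ≤ ((thetaFEPair z).f_modif t).re := by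
  rw [re_f_modif_of_one_lt z ht]
  linarith [one_add_two_exp_le_thetaQ z (zero_lt_one.trans ht)]

/-! ## Oesterlé's (22): the folded theta integral for `Λ₀` on the real axis -/

/-- The `(0, 1)` part of Riemann's integral, folded onto `(1, ∞)` by `t ↦ 1/t` and the theta
functional equation `Θ_z(t) = t⁻¹Θ_z(1/t)`:
`∫₀¹ t^{σ−1}(Θ_z(t) − t⁻¹) dt = ∫₁^∞ u^{−σ}(Θ_z(u) − 1) du`. [cite: Oesterle1988Gauss, II §2 (21)–(22)] -/
theorem integral_Ioo_eq_integral_Ioi (z : ℍ) (σ : ℝ) :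
    ∫ t in Ioo (0 : ℝ) 1, t ^ (σ - 1) * ((thetaFEPair z).f_modif t).re =
      ∫ u in Ioi (1 : ℝ), u ^ (-σ) * (thetaQ z u - 1) := by
  set g : ℝ → ℝ := fun u => u ^ (-σ) * (thetaQ z u - 1) with hg
  have key := integral_comp_rpow_Ioi (indicator (Ioi 1) g) (p := -1) (by norm_num)
  rw [setIntegral_indicator measurableSet_Ioi,
    show Ioi (0 : ℝ) ∩ Ioi 1 = Ioi 1 from inter_eq_right.mpr (Ioi_subset_Ioi zero_le_one)] at key
  rw [← key]
  have hL : EqOn (fun x : ℝ => (|(-1 : ℝ)| * x ^ ((-1 : ℝ) - 1)) • indicator (Ioi 1) g (x ^ (-1 : ℝ)))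
      (indicator (Ioo 0 1) fun t => t ^ (σ - 1) * ((thetaFEPair z).f_modif t).re) (Ioi 0) := by
    intro x hx
    have hx0 : 0 < x := hx
    simp only
    have hx1 : x ^ (-1 : ℝ) = x⁻¹ := Real.rpow_neg_one x
    by_cases h1 : x < 1
    · have hmem : x ^ (-1 : ℝ) ∈ Ioi (1 : ℝ) := by
        rw [hx1]; exact one_lt_inv₀ hx0 |>.2 h1
      rw [indicator_of_mem hmem, indicator_of_mem (show x ∈ Ioo (0 : ℝ) 1 from ⟨hx0, h1⟩), smul_eq_mul,
        show |(-1 : ℝ)| = 1 by norm_num, one_mul, hg, re_f_modif_of_mem_Ioo z ⟨hx0, h1⟩]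
      simp only
      rw [hx1, thetaQ_eq_inv_mul z hx0, one_div]
      have e1 : (x⁻¹) ^ (-σ) = x ^ σ := by
        rw [Real.inv_rpow hx0.le, ← Real.rpow_neg hx0.le, neg_neg]
      rw [e1, show (-1 : ℝ) - 1 = -2 by norm_num]
      have e2 : x ^ (-2 : ℝ) * x ^ σ = x ^ (σ - 1) * x⁻¹ := by
        rw [← Real.rpow_add hx0, ← Real.rpow_neg_one, ← Real.rpow_add hx0]; ring_nf
      calc x ^ (-2 : ℝ) * (x ^ σ * (thetaQ z x⁻¹ - 1))
          = (x ^ (-2 : ℝ) * x ^ σ) * (thetaQ z x⁻¹ - 1) := by ring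
        _ = x ^ (σ - 1) * x⁻¹ * (thetaQ z x⁻¹ - 1) := by rw [e2]
        _ = x ^ (σ - 1) * (x⁻¹ * thetaQ z x⁻¹ - x⁻¹) := by ring
    · have hnot : x ^ (-1 : ℝ) ∉ Ioi (1 : ℝ) := by
        rw [hx1]; intro h
        exact absurd (inv_le_one_of_one_le₀ (not_lt.1 h1)) (not_le.2 h)
      have hnot' : x ∉ Ioo (0 : ℝ) 1 := fun h => h1 h.2
      rw [indicator_of_notMem hnot, indicator_of_notMem hnot', smul_zero]
  rw [setIntegral_congr_fun measurableSet_Ioi hL, setIntegral_indicator measurableSet_Ioo,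
    show Ioi (0 : ℝ) ∩ Ioo 0 1 = Ioo 0 1 from inter_eq_right.mpr Ioo_subset_Ioi_self]

/-- Integrability of `u ↦ u^{−σ}(Θ_z(u) − 1)` on `(1, ∞)` (it is the `(1, ∞)` part of Riemann's
integrand at `1 − σ`). [folklore] -/
private theorem integrableOn_rpow_neg_mul_thetaQ_sub_one (z : ℍ) (σ : ℝ) :
    IntegrableOn (fun u : ℝ => u ^ (-σ) * (thetaQ z u - 1)) (Ioi 1) := by
  have h := (integrableOn_re_integrand z (1 - σ)).mono_set (Ioi_subset_Ioi zero_le_one)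
  refine h.congr_fun (fun u hu => ?_) measurableSet_Ioi
  have hu : (1 : ℝ) < u := hu
  simp only
  rw [re_f_modif_of_one_lt z hu, show (1 - σ) - 1 = -σ by ring]

/-- Integrability of `t ↦ t^{σ−1}(Θ_z(t) − 1)` on `(1, ∞)`. [folklore] -/
private theorem integrableOn_rpow_mul_thetaQ_sub_one (z : ℍ) (σ : ℝ) :
    IntegrableOn (fun u : ℝ => u ^ (σ - 1) * (thetaQ z u - 1)) (Ioi 1) := by
  have h := (integrableOn_re_integrand z σ).mono_set (Ioi_subset_Ioi zero_le_one)
  refine h.congr_fun (fun u hu => ?_) measurableSet_Ioi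
  have hu : (1 : ℝ) < u := hu
  simp only
  rw [re_f_modif_of_one_lt z hu]

/-- **Oesterlé's formula (22) on the real axis**: for real `σ` and `z ∈ ℍ`,
`Re Λ₀,z(σ) = ∫₁^∞ (Θ_z(t) − 1)(t^{σ−1} + t^{−σ}) dt`, where `Λ₀ = Λ + 1/s + 1/(1 − s)` is the entire
part of the completed Epstein zeta function `Λ_z` (Riemann's theta integral, split at `t = 1` and
folded). [cite: Oesterle1988Gauss, II §2 (22)] -/
theorem re_Λ₀_eq_integral_Ioi_one (z : ℍ) (σ : ℝ) :
    ((thetaFEPair z).Λ₀ σ).re =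
      ∫ t in Ioi (1 : ℝ), (t ^ (σ - 1) + t ^ (-σ)) * (thetaQ z t - 1) := by
  rw [re_Λ₀_eq_integral]
  have hint := integrableOn_re_integrand z σ
  -- split `(0, ∞) = (0, 1) ∪ [1, ∞)` (the point `1` is null)
  have hsplit : ∫ t in Ioi (0 : ℝ), t ^ (σ - 1) * ((thetaFEPair z).f_modif t).re =
      (∫ t in Ioo (0 : ℝ) 1, t ^ (σ - 1) * ((thetaFEPair z).f_modif t).re) +
        ∫ t in Ioi (1 : ℝ), t ^ (σ - 1) * ((thetaFEPair z).f_modif t).re := by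
    rw [← Ioc_union_Ioi_eq_Ioi zero_le_one, setIntegral_union (Ioc_disjoint_Ioi le_rfl)
      measurableSet_Ioi (hint.mono_set Ioc_subset_Ioi_self) (hint.mono_set (Ioi_subset_Ioi zero_le_one)),
      integral_Ioc_eq_integral_Ioo]
  rw [hsplit, integral_Ioo_eq_integral_Ioi]
  have h2 : ∫ t in Ioi (1 : ℝ), t ^ (σ - 1) * ((thetaFEPair z).f_modif t).re =
      ∫ t in Ioi (1 : ℝ), t ^ (σ - 1) * (thetaQ z t - 1) :=
    setIntegral_congr_fun measurableSet_Ioi fun t ht => by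
      show t ^ (σ - 1) * ((thetaFEPair z).f_modif t).re = t ^ (σ - 1) * (thetaQ z t - 1)
      rw [re_f_modif_of_one_lt z ht]
  rw [h2, ← integral_add (integrableOn_rpow_neg_mul_thetaQ_sub_one z σ)
    (integrableOn_rpow_mul_thetaQ_sub_one z σ)]
  refine setIntegral_congr_fun measurableSet_Ioi fun t _ => ?_
  show t ^ (-σ) * (thetaQ z t - 1) + t ^ (σ - 1) * (thetaQ z t - 1) = (t ^ (σ - 1) + t ^ (-σ)) * (thetaQ z t - 1)
  ring

/-- **The neutral-class minorant** (Oesterlé p. 58: «et même supérieur à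
`2∫₁^∞ e^{−2πt/√d}(t^{α−1} + t^{−α}) dt` lorsque `C` est la classe neutre»): for every `z ∈ ℍ` and
real `σ`, `Re Λ₀,z(σ) ≥ 2∫₁^∞ e^{−πt/y}(t^{σ−1} + t^{−σ}) dt` with `y = Im z` (for the principal
form of discriminant `−d`, `y = √d/2` and `e^{−πt/y} = e^{−2πt/√d}`): keep the theta terms
`(0, ±1)` only. [cite: Oesterle1988Gauss, II §3, proof of the Proposition p. 58] -/
theorem re_Λ₀_ge (z : ℍ) (σ : ℝ) :
    2 * ∫ t in Ioi (1 : ℝ), Real.exp (-(Real.pi * t / z.im)) * (t ^ (σ - 1) + t ^ (-σ)) ≤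
      ((thetaFEPair z).Λ₀ σ).re := by
  rw [re_Λ₀_eq_integral_Ioi_one, ← integral_const_mul]
  have hint : IntegrableOn (fun t : ℝ => (t ^ (σ - 1) + t ^ (-σ)) * (thetaQ z t - 1)) (Ioi 1) := by
    have := (integrableOn_rpow_mul_thetaQ_sub_one z σ).add (integrableOn_rpow_neg_mul_thetaQ_sub_one z σ)
    exact this.congr_fun (fun t _ => by simp only [Pi.add_apply]; ring) measurableSet_Ioi
  have hle : ∀ t ∈ Ioi (1 : ℝ), 2 * (Real.exp (-(Real.pi * t / z.im)) * (t ^ (σ - 1) + t ^ (-σ))) ≤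
      (t ^ (σ - 1) + t ^ (-σ)) * (thetaQ z t - 1) := by
    intro t ht
    have ht0 : (0 : ℝ) < t := zero_lt_one.trans ht
    have hpow : 0 ≤ t ^ (σ - 1) + t ^ (-σ) := by positivity
    have hθ := one_add_two_exp_le_thetaQ z ht0
    calc 2 * (Real.exp (-(Real.pi * t / z.im)) * (t ^ (σ - 1) + t ^ (-σ)))
        = (t ^ (σ - 1) + t ^ (-σ)) * (2 * Real.exp (-(Real.pi * t / z.im))) := by ring
      _ ≤ (t ^ (σ - 1) + t ^ (-σ)) * (thetaQ z t - 1) :=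
          mul_le_mul_of_nonneg_left (by linarith) hpow
  have hmeas : AEStronglyMeasurable
      (fun t : ℝ => 2 * (Real.exp (-(Real.pi * t / z.im)) * (t ^ (σ - 1) + t ^ (-σ))))
      (volume.restrict (Ioi (1 : ℝ))) := by
    refine (ContinuousOn.mul continuousOn_const (ContinuousOn.mul (by fun_prop) ?_)).aestronglyMeasurable
      measurableSet_Ioi
    exact ContinuousOn.add (continuousOn_id.rpow_const fun t ht => Or.inl (zero_lt_one.trans ht).ne')
      (continuousOn_id.rpow_const fun t ht => Or.inl (zero_lt_one.trans ht).ne')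
  have hnn : ∀ t ∈ Ioi (1 : ℝ), 0 ≤ 2 * (Real.exp (-(Real.pi * t / z.im)) * (t ^ (σ - 1) + t ^ (-σ))) := by
    intro t ht
    have ht0 : (0 : ℝ) < t := zero_lt_one.trans ht
    positivity
  have hint' : IntegrableOn
      (fun t : ℝ => 2 * (Real.exp (-(Real.pi * t / z.im)) * (t ^ (σ - 1) + t ^ (-σ)))) (Ioi 1) := by
    refine Integrable.mono' hint hmeas ?_
    filter_upwards [self_mem_ae_restrict measurableSet_Ioi] with t ht
    rw [Real.norm_of_nonneg (hnn t ht)]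
    exact hle t ht
  exact setIntegral_mono_on hint' hint measurableSet_Ioi hle


/-! ## The class-by-class sign argument (Oesterlé p. 58) -/

section ClassSum

open Literature.NumberTheory.LFunctions (riemannZeta_im_eq_zero_of_pos riemannZeta_re_neg_of_pos_of_lt_one)
open Literature.NumberTheory.LFunctions.DirichletAbel (LFunction_ofReal_im_eq_zero)
open Literature.NumberTheory.LFunctions.PrimitiveQuadratic (isFundamentalDiscriminant_neg)

/-- **Each class: `Λ(C, α) + (α(1−α))⁻¹ ≥ 0`, transported to the continuation.** For a reduced form
`(a, b, c)` of discriminant `−d` and ANY analytic continuation `Z` of `ζ_Q`, at a real point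
`α ∈ (0, 1)`: `Re Z(α) ≥ −c_d(α)·(1/α + 1/(1−α))` with the positive factor
`c_d(α) = π^α (√d/2)^{−α}/Γ(α)` (the same for every class): `Z(α) = c_d(α)Λ_{z}(α)` for the Heegner
point `z = (b + i√d)/(2a)` of the swapped form, `Λ_z = Λ₀,z − 1/s − 1/(1−s)` and `Λ₀,z(α) ≥ 0`.
[cite: Oesterle1988Gauss, II §3, proof of the Proposition p. 58] -/
theorem re_continuation_ge_of_mem_reducedForms {d : ℕ} (hd : 4 < d) {a b c : ℤ}
    (hQ : (a, b, c) ∈ reducedForms (-(d : ℤ))) {Z : ℂ → ℂ}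
    (hZ : IsEpsteinContinuation (a : ℝ) (b : ℝ) (c : ℝ) Z) {α : ℝ} (hα0 : 0 < α) (hα1 : α < 1) :
    -(Real.pi ^ α * (Real.sqrt d / 2) ^ (-α) / Real.Gamma α * (1 / α + 1 / (1 - α))) ≤ (Z α).re := by
  have hD0 : (-(d : ℤ)) < 0 := by omega
  obtain ⟨hdisc, ha, -, -⟩ := (mem_reducedForms_iff hD0).1 hQ
  simp only at ha
  rw [discr_apply] at hdisc
  have haR : (0 : ℝ) < a := by exact_mod_cast ha
  have hdR : (4 : ℝ) * c * a - (b : ℝ) ^ 2 = d := by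
    have : (4 : ℝ) * a * c - (b : ℝ) ^ 2 = d := by exact_mod_cast (by linarith : 4 * a * c - b ^ 2 = (d : ℤ))
    linarith
  have hd0 : (0 : ℝ) < d := by exact_mod_cast (by omega : 0 < d)
  have hpos : IsPosDefForm (a : ℝ) (b : ℝ) (c : ℝ) := ⟨haR, by nlinarith⟩
  obtain ⟨z, hre, him, -⟩ := exists_zQ' hpos
  have hZ' : IsEpsteinContinuation (c : ℝ) (b : ℝ) (a : ℝ) Z := (isEpsteinContinuation_swap_iff _ _ _ Z).2 hZ
  rw [continuation_ofReal_eq hpos.swap z hre him hZ' hα0 hα1, Complex.re_ofReal_mul, hdR, re_Λ_ofReal]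
  have hC := realFactor_pos hpos.swap hα0
  rw [hdR] at hC
  have hΛ₀ : 0 ≤ ((thetaFEPair z).Λ₀ α).re := by
    refine le_trans ?_ (re_Λ₀_ge z α)
    refine mul_nonneg (by norm_num) (setIntegral_nonneg measurableSet_Ioi fun t ht => ?_)
    have ht0 : (0 : ℝ) < t := zero_lt_one.trans ht
    positivity
  have : Real.pi ^ α * (Real.sqrt d / 2) ^ (-α) / Real.Gamma α * (-(1 / α + 1 / (1 - α))) ≤
      Real.pi ^ α * (Real.sqrt d / 2) ^ (-α) / Real.Gamma α * (((thetaFEPair z).Λ₀ α).re - 1 / α - 1 / (1 - α)) :=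
    mul_le_mul_of_nonneg_left (by linarith) hC.le
  linarith

/-- **The neutral class** (the principal form `(1, b₀, c₀)`, Heegner point of height `√d/2`):
`Re Z(α) ≥ c_d(α)·(2∫₁^∞ e^{−2πt/√d}(t^{α−1} + t^{−α}) dt − 1/α − 1/(1−α))`.
[cite: Oesterle1988Gauss, II §3, proof of the Proposition p. 58] -/
theorem re_continuation_principalForm_ge {d : ℕ} (hd : 4 < d)
    (h4 : (-(d : ℤ)) % 4 = 0 ∨ (-(d : ℤ)) % 4 = 1) {Z : ℂ → ℂ}
    (hZ : IsEpsteinContinuation ((principalForm (-(d : ℤ))).1 : ℝ) ((principalForm (-(d : ℤ))).2.1 : ℝ)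
      ((principalForm (-(d : ℤ))).2.2 : ℝ) Z) {α : ℝ} (hα0 : 0 < α) (hα1 : α < 1) :
    Real.pi ^ α * (Real.sqrt d / 2) ^ (-α) / Real.Gamma α *
        (2 * (∫ t in Ioi (1 : ℝ), Real.exp (-(2 * Real.pi * t / Real.sqrt d)) * (t ^ (α - 1) + t ^ (-α))) -
          (1 / α + 1 / (1 - α))) ≤ (Z α).re := by
  have hD0 : (-(d : ℤ)) < 0 := by omega
  set Q := principalForm (-(d : ℤ)) with hQdef
  have hQ : (Q.1, Q.2.1, Q.2.2) ∈ reducedForms (-(d : ℤ)) := principalForm_mem_reducedForms hD0 h4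
  have hQ1 : Q.1 = 1 := principalForm_fst _
  obtain ⟨hdisc, -, -, -⟩ := (mem_reducedForms_iff hD0).1 hQ
  rw [discr_apply, hQ1] at hdisc
  have hdR : (4 : ℝ) * (Q.2.2 : ℝ) * 1 - (Q.2.1 : ℝ) ^ 2 = d := by
    have : (4 : ℝ) * 1 * (Q.2.2 : ℝ) - (Q.2.1 : ℝ) ^ 2 = d := by
      exact_mod_cast (by linarith : 4 * 1 * Q.2.2 - Q.2.1 ^ 2 = (d : ℤ))
    linarith
  have hd0 : (0 : ℝ) < d := by exact_mod_cast (by omega : 0 < d)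
  have hpos : IsPosDefForm (1 : ℝ) (Q.2.1 : ℝ) (Q.2.2 : ℝ) := ⟨one_pos, by nlinarith⟩
  obtain ⟨z, hre, him, -⟩ := exists_zQ' hpos
  have hZ1 : IsEpsteinContinuation (1 : ℝ) (Q.2.1 : ℝ) (Q.2.2 : ℝ) Z := by
    have e : ((Q.1 : ℤ) : ℝ) = 1 := by rw [hQ1]; norm_num
    simpa [e] using hZ
  have hZ' : IsEpsteinContinuation (Q.2.2 : ℝ) (Q.2.1 : ℝ) (1 : ℝ) Z :=
    (isEpsteinContinuation_swap_iff _ _ _ Z).2 hZ1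
  rw [continuation_ofReal_eq hpos.swap z hre him hZ' hα0 hα1, Complex.re_ofReal_mul, hdR, re_Λ_ofReal]
  have hC := realFactor_pos hpos.swap hα0
  rw [hdR] at hC
  have hy : z.im = Real.sqrt d / 2 := by rw [him, hdR]; ring
  have hΛ₀ := re_Λ₀_ge z α
  rw [hy] at hΛ₀
  have e : (fun t : ℝ => Real.exp (-(Real.pi * t / (Real.sqrt d / 2))) * (t ^ (α - 1) + t ^ (-α))) =
      fun t : ℝ => Real.exp (-(2 * Real.pi * t / Real.sqrt d)) * (t ^ (α - 1) + t ^ (-α)) := by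
    funext t; congr 2; ring
  rw [e] at hΛ₀
  refine mul_le_mul_of_nonneg_left ?_ hC.le
  linarith

/-- **`ζ_K(α) ≤ 0` from the absence of real zeros in `(α, 1)`** (Oesterlé: «Soit `α ∈ ]½, 1[` tel que
`ζ_K` ne s'annule pas dans l'intervalle `]α, 1[`. On a alors `ζ_K(α) ≤ 0`»), in the form
`Re L(α, χ) ≥ 0` for the odd real primitive character `χ` mod `d > 4` (`ζ(α) < 0` on `(0, 1)`):
`L(σ, χ)` is real and continuous on `[α, 1)`, positive on `[1 − 2/(5√d), 1)`
(`LFunction_re_pos_of_odd_quadratic`), so a negative value at `α` would produce a zero in `(α, 1)`.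
[cite: Oesterle1988Gauss, II §3, proof of the Proposition p. 58] -/
theorem LFunction_re_nonneg_of_no_realZero {d : ℕ} [NeZero d] (hd : 4 < d)
    {χ : DirichletCharacter ℂ d} (hprim : χ.IsPrimitive) (hquad : χ.IsQuadratic) (hodd : χ.Odd)
    {α : ℝ} (hα0 : 0 < α) (hα1 : α < 1) (hL : ∀ σ : ℝ, α < σ → σ < 1 → χ.LFunction σ ≠ 0) :
    0 ≤ (χ.LFunction α).re := by
  have hχ1 : χ ≠ 1 := by
    intro h
    have h1 : χ (-1) = -1 := hodd
    rw [h, MulChar.one_apply (isUnit_one.neg)] at h1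
    norm_num at h1
  have hsq : χ ^ 2 = 1 := MulChar.IsQuadratic.sq_eq_one hquad
  set σ₁ : ℝ := 1 - 2 / (5 * Real.sqrt d) with hσ₁
  have hd4R : (4 : ℝ) < d := by exact_mod_cast hd
  have hsd : 2 ≤ Real.sqrt d := (Real.le_sqrt' two_pos).2 (by linarith)
  have h25 : 0 < 2 / (5 * Real.sqrt d) := by positivity
  have hσ₁1 : σ₁ < 1 := by rw [hσ₁]; linarith
  by_cases hα : σ₁ ≤ α
  · exact (LFunction_re_pos_of_odd_quadratic hd hprim hquad hodd hα hα1).le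
  push Not at hα
  by_contra hneg
  push Not at hneg
  -- continuity of `σ ↦ Re L(σ, χ)` on `[α, σ₁]`
  have hcont : ContinuousOn (fun σ : ℝ => (χ.LFunction σ).re) (Icc α σ₁) :=
    (Complex.continuous_re.comp ((DirichletCharacter.differentiable_LFunction hχ1).continuous.comp
      Complex.continuous_ofReal)).continuousOn
  have hpos : 0 < (χ.LFunction σ₁).re := LFunction_re_pos_of_odd_quadratic hd hprim hquad hodd le_rfl hσ₁1
  have hivt := intermediate_value_Icc hα.le hcont
  have h0mem : (0 : ℝ) ∈ Icc (χ.LFunction (α : ℂ)).re (χ.LFunction (σ₁ : ℂ)).re := ⟨hneg.le, hpos.le⟩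
  obtain ⟨β, hβ, hβ0⟩ := hivt h0mem
  have hβ0 : (χ.LFunction β).re = 0 := hβ0
  have hβα : α < β := by
    rcases eq_or_lt_of_le hβ.1 with h | h
    · rw [← h] at hβ0; linarith
    · exact h
  have hβ1 : β < 1 := lt_of_le_of_lt hβ.2 hσ₁1
  refine hL β hβα hβ1 (Complex.ext ?_ ?_)
  · simpa using hβ0
  · simpa using LFunction_ofReal_im_eq_zero χ hχ1 hsq (hα0.trans hβα)

/-- **Hecke–Landau–Oesterlé, the displayed inequality** (Oesterlé 1988, II §3, proof of the
Proposition, p. 58): let `χ` be the odd real primitive character mod `d > 4` (the Kronecker character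
of `K = ℚ(√−d)`, `ζ_K = ζ·L(·, χ)`), `h(−d)` the number of reduced primitive positive definite forms
of discriminant `−d` (`= h_K`), and `0 < α < 1` such that `L(s, χ)` (equivalently `ζ_K`, as
`ζ(σ) < 0` on `(0, 1)`) has no real zero in `(α, 1)`. Then
`h(−d) ≥ 2α(1 − α) ∫₁^∞ e^{−2πt/√d} (t^{α−1} + t^{−α}) dt`.
Proof as printed: `ζ(α)L(α, χ) = ½Σ_{Q reduced} Z_Q(α) ≤ 0`, every class contributes
`≥ −c_d(α)(1/α + 1/(1−α))` and the neutral class `≥ c_d(α)(2∫₁^∞ … − 1/α − 1/(1−α))`, `c_d(α) > 0`.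
[cite: Oesterle1988Gauss, II §3, proof of the Proposition p. 58] -/
theorem classNumber_ge_integral {d : ℕ} [NeZero d] (hd : 4 < d)
    {χ : DirichletCharacter ℂ d} (hprim : χ.IsPrimitive) (hquad : χ.IsQuadratic) (hodd : χ.Odd)
    {α : ℝ} (hα0 : 0 < α) (hα1 : α < 1) (hL : ∀ σ : ℝ, α < σ → σ < 1 → χ.LFunction σ ≠ 0) :
    2 * α * (1 - α) * ∫ t in Ioi (1 : ℝ), Real.exp (-(2 * Real.pi * t / Real.sqrt d)) * (t ^ (α - 1) + t ^ (-α))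
      ≤ (classNumber (-(d : ℤ)) : ℝ) := by
  classical
  have hχ1 : χ ≠ 1 := by
    intro h
    have h1 : χ (-1) = -1 := hodd
    rw [h, MulChar.one_apply (isUnit_one.neg)] at h1
    norm_num at h1
  have hsq : χ ^ 2 = 1 := MulChar.IsQuadratic.sq_eq_one hquad
  have hD0 : (-(d : ℤ)) < 0 := by omega
  have h4 : (-(d : ℤ)) % 4 = 0 ∨ (-(d : ℤ)) % 4 = 1 := by
    rcases isFundamentalDiscriminant_neg hprim hquad hodd with ⟨h1, -, -⟩ | ⟨h0, -, -⟩
    · exact Or.inr h1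
    · exact Or.inl (Int.emod_eq_zero_of_dvd h0)
  set S := reducedForms (-(d : ℤ)) with hS
  -- continuations of the class zeta functions
  have hex : ∀ Q : ℤ × ℤ × ℤ, ∃ Z : ℂ → ℂ,
      Q ∈ S → IsEpsteinContinuation (Q.1 : ℝ) (Q.2.1 : ℝ) (Q.2.2 : ℝ) Z := by
    intro Q
    by_cases hQ : Q ∈ S
    · obtain ⟨hdisc, ha, -, hred⟩ := (mem_reducedForms_iff hD0).1 hQ
      rw [show Q = (Q.1, Q.2.1, Q.2.2) from rfl, discr_apply] at hdisc
      have hpos : IsPosDefForm (Q.1 : ℝ) (Q.2.1 : ℝ) (Q.2.2 : ℝ) := by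
        refine ⟨by exact_mod_cast ha, ?_⟩
        have : (Q.2.1 : ℝ) ^ 2 - 4 * (Q.1 : ℝ) * (Q.2.2 : ℝ) = ((-(d : ℤ) : ℤ) : ℝ) := by
          exact_mod_cast hdisc
        rw [this]; push_cast
        have : (0 : ℝ) < d := by exact_mod_cast (by omega : 0 < d)
        linarith
      obtain ⟨Z, hZ, -⟩ := MontgomeryVaughan2007_epsteinContinuation_holds _ _ _ hpos
      exact ⟨Z, fun _ => hZ⟩
    · exact ⟨0, fun h => absurd h hQ⟩
  choose Z hZ using hex
  set G : ℂ → ℂ := fun s => 1 / 2 * ∑ Q ∈ S, Z Q s with hGdef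
  set F : ℂ → ℂ := fun s => riemannZeta s * χ.LFunction s with hFdef
  -- both sides are analytic on `ℂ ∖ {1}` and agree on `Re s > 1`
  have hU : IsOpen {s : ℂ | s ≠ 1} := isOpen_ne
  have hFd : DifferentiableOn ℂ F {s : ℂ | s ≠ 1} := fun s hs =>
    ((differentiableAt_riemannZeta hs).mul
      ((DirichletCharacter.differentiable_LFunction hχ1) s)).differentiableWithinAt
  have hGd : DifferentiableOn ℂ G {s : ℂ | s ≠ 1} :=
    (differentiableOn_const _).mul (DifferentiableOn.fun_sum fun Q hQ => (hZ Q hQ).1)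
  have hFG : EqOn F G {s : ℂ | s ≠ 1} := by
    refine (hFd.analyticOnNhd hU).eqOn_of_preconnected_of_eventuallyEq (hGd.analyticOnNhd hU)
      isPreconnected_compl_one (show (2 : ℂ) ∈ {s : ℂ | s ≠ 1} by norm_num) ?_
    have hopen : IsOpen {s : ℂ | 1 < s.re} := isOpen_lt continuous_const Complex.continuous_re
    filter_upwards [hopen.mem_nhds (show (2 : ℂ) ∈ {s : ℂ | 1 < s.re} by simp)] with s hs
    have hs' : 1 < s.re := hs
    simp only [hFdef, hGdef]
    rw [riemannZeta_mul_LFunction_eq_half_sum_of_one_lt_re hd hprim hquad hodd hs']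
    congr 1
    exact Finset.sum_congr rfl fun Q hQ => ((hZ Q hQ).2 s hs').symm
  -- at the real point `α`: `Re F(α) ≤ 0`
  have hαU : ((α : ℂ)) ∈ {s : ℂ | s ≠ 1} := by
    simp only [Set.mem_setOf_eq]
    exact_mod_cast hα1.ne
  have heq := hFG hαU
  simp only [hFdef, hGdef] at heq
  have hLre := LFunction_re_nonneg_of_no_realZero hd hprim hquad hodd hα0 hα1 hL
  have hFle : (riemannZeta α * χ.LFunction α).re ≤ 0 := by
    rw [Complex.mul_re, riemannZeta_im_eq_zero_of_pos hα0 hα1.ne, zero_mul, sub_zero]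
    exact mul_nonpos_of_nonpos_of_nonneg (riemannZeta_re_neg_of_pos_of_lt_one hα0 hα1).le hLre
  rw [heq, show (1 : ℂ) / 2 = ((1 / 2 : ℝ) : ℂ) by push_cast; ring, Complex.re_ofReal_mul,
    Complex.re_sum] at hFle
  have hsum : ∑ Q ∈ S, (Z Q α).re ≤ 0 := by linarith
  -- the principal form and the others
  set P := principalForm (-(d : ℤ)) with hPdef
  have hPmem : P ∈ S := principalForm_mem_reducedForms hD0 h4
  set C : ℝ := Real.pi ^ α * (Real.sqrt d / 2) ^ (-α) / Real.Gamma α with hCdef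
  set A : ℝ := 1 / α + 1 / (1 - α) with hAdef
  set M : ℝ := ∫ t in Ioi (1 : ℝ), Real.exp (-(2 * Real.pi * t / Real.sqrt d)) * (t ^ (α - 1) + t ^ (-α))
    with hMdef
  have hC : 0 < C := by
    have hd0 : (0 : ℝ) < d := by exact_mod_cast (by omega : 0 < d)
    have h1 : 0 < Real.pi ^ α := Real.rpow_pos_of_pos Real.pi_pos α
    have h2 : 0 < (Real.sqrt d / 2) ^ (-α) := Real.rpow_pos_of_pos (by positivity) _
    have h3 := Real.Gamma_pos_of_pos hα0
    positivity
  have hrest : ∀ Q ∈ S.erase P, -(C * A) ≤ (Z Q α).re := fun Q hQ =>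
    re_continuation_ge_of_mem_reducedForms hd (a := Q.1) (b := Q.2.1) (c := Q.2.2)
      (Finset.mem_of_mem_erase hQ) (hZ Q (Finset.mem_of_mem_erase hQ)) hα0 hα1
  have hP : C * (2 * M - A) ≤ (Z P α).re :=
    re_continuation_principalForm_ge hd h4 (hZ P hPmem) hα0 hα1
  rw [← Finset.add_sum_erase S _ hPmem] at hsum
  have hrest' : ∑ Q ∈ S.erase P, (-(C * A)) ≤ ∑ Q ∈ S.erase P, (Z Q α).re := Finset.sum_le_sum hrest
  rw [Finset.sum_const, nsmul_eq_mul, Finset.card_erase_of_mem hPmem] at hrest'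
  -- `C(2M − A) − (h − 1)·C·A ≤ 0`, i.e. `2M ≤ h·A`
  have hcard : 1 ≤ S.card := Finset.card_pos.2 ⟨P, hPmem⟩
  have hcast : (((S.card - 1 : ℕ)) : ℝ) = (S.card : ℝ) - 1 := by
    rw [Nat.cast_sub hcard, Nat.cast_one]
  rw [hcast] at hrest'
  have hkey : C * (2 * M - S.card * A) ≤ 0 := by nlinarith
  have h2M : 2 * M - S.card * A ≤ 0 := by
    by_contra h
    push Not at h
    have := mul_pos hC h
    linarith
  have h1α : (1 - α) ≠ 0 := by linarith
  have hA : A = 1 / (α * (1 - α)) := by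
    rw [hAdef]; field_simp; ring
  have hαα : 0 < α * (1 - α) := mul_pos hα0 (by linarith)
  rw [hA] at h2M
  have h3 : 2 * M * (α * (1 - α)) ≤ S.card := by
    have := mul_le_mul_of_nonneg_right (by linarith [h2M] : 2 * M ≤ S.card * (1 / (α * (1 - α)))) hαα.le
    rwa [mul_assoc (S.card : ℝ), one_div_mul_cancel hαα.ne', mul_one] at this
  show 2 * α * (1 - α) * M ≤ (S.card : ℝ)
  calc 2 * α * (1 - α) * M = 2 * M * (α * (1 - α)) := by ring
    _ ≤ S.card := h3

end ClassSum


/-! ## Explicit lower bounds for the minorant integral (Oesterlé p. 58, «Prenons alors `α` égal à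
`1 − (2/log d)`»)

The printed chain of numerical inequalities on p. 58–59 is replaced by the following elementary
bounds (same architecture: the `(1, ∞)`-term is a truncated `Γ`-integral, the `t^{−α}`-term is cut at
`t = √d/(2π)`), sufficient for the printed constant `2/(πe)`. -/

section Explicit

/-- `Γ(x) ≥ 1` for `0 < x ≤ 1`: convexity of `Γ` on `(0, ∞)` (Bohr–Mollerup) with `Γ(1) = Γ(2) = 1`.
[folklore] -/
private theorem one_le_Gamma_of_le_one {x : ℝ} (hx0 : 0 < x) (hx1 : x ≤ 1) : 1 ≤ Real.Gamma x := by
  rcases eq_or_lt_of_le hx1 with rfl | hlt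
  · rw [Real.Gamma_one]
  have h := Real.convexOn_Gamma.slope_mono_adjacent (x := x) (y := 1) (z := 2) hx0
    (show (2 : ℝ) ∈ Ioi 0 by norm_num) hlt one_lt_two
  rw [Real.Gamma_one, Real.Gamma_two] at h
  norm_num at h
  have h1x : 0 < 1 - x := by linarith
  have h' : (1 - Real.Gamma x) / (1 - x) ≤ 0 := h
  rw [div_nonpos_iff] at h'
  rcases h' with ⟨-, h2⟩ | ⟨h2, -⟩
  · linarith
  · linarith

/-- The `(1, ∞)`-piece with `t^{α−1}`: `∫₁^∞ e^{−ct} t^{α−1} dt ≥ c^{−α}Γ(α) − 1/α` (`c, α > 0`):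
the complete integral is `c^{−α}Γ(α)` and `∫₀¹ e^{−ct}t^{α−1} dt ≤ ∫₀¹ t^{α−1} dt = 1/α`. [folklore] -/
private theorem integral_Ioi_one_exp_mul_rpow_ge {c α : ℝ} (hc : 0 < c) (hα : 0 < α) :
    (1 / c) ^ α * Real.Gamma α - 1 / α ≤ ∫ t in Ioi (1 : ℝ), Real.exp (-(c * t)) * t ^ (α - 1) := by
  have hfull : ∫ t in Ioi (0 : ℝ), t ^ (α - 1) * Real.exp (-(c * t)) = (1 / c) ^ α * Real.Gamma α :=
    Real.integral_rpow_mul_exp_neg_mul_Ioi hα hc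
  have hval : 0 < (1 / c) ^ α * Real.Gamma α := by
    have := Real.Gamma_pos_of_pos hα
    positivity
  have hint : IntegrableOn (fun t : ℝ => t ^ (α - 1) * Real.exp (-(c * t))) (Ioi 0) := by
    by_contra h
    rw [integral_undef h] at hfull
    linarith
  have hsplit : ∫ t in Ioi (0 : ℝ), t ^ (α - 1) * Real.exp (-(c * t)) =
      (∫ t in Ioc (0 : ℝ) 1, t ^ (α - 1) * Real.exp (-(c * t))) +
        ∫ t in Ioi (1 : ℝ), t ^ (α - 1) * Real.exp (-(c * t)) := by
    rw [← Ioc_union_Ioi_eq_Ioi zero_le_one, setIntegral_union (Ioc_disjoint_Ioi le_rfl)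
      measurableSet_Ioi (hint.mono_set Ioc_subset_Ioi_self) (hint.mono_set (Ioi_subset_Ioi zero_le_one))]
  have hIoc : ∫ t in Ioc (0 : ℝ) 1, t ^ (α - 1) * Real.exp (-(c * t)) ≤ 1 / α := by
    have hrpow : IntegrableOn (fun t : ℝ => t ^ (α - 1)) (Ioc 0 1) :=
      (intervalIntegral.intervalIntegrable_rpow' (by linarith : -1 < α - 1) (a := 0) (b := 1)).1
    have h1 : ∫ t in Ioc (0 : ℝ) 1, t ^ (α - 1) * Real.exp (-(c * t)) ≤ ∫ t in Ioc (0 : ℝ) 1, t ^ (α - 1) := by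
      refine setIntegral_mono_on (hint.mono_set Ioc_subset_Ioi_self) hrpow measurableSet_Ioc
        fun t ht => ?_
      have hexp : Real.exp (-(c * t)) ≤ 1 := by
        rw [Real.exp_le_one_iff]; nlinarith [ht.1]
      calc t ^ (α - 1) * Real.exp (-(c * t)) ≤ t ^ (α - 1) * 1 :=
            mul_le_mul_of_nonneg_left hexp (Real.rpow_nonneg ht.1.le _)
        _ = t ^ (α - 1) := mul_one _
    have h2 : ∫ t in Ioc (0 : ℝ) 1, t ^ (α - 1) = 1 / α := by
      rw [← intervalIntegral.integral_of_le zero_le_one, integral_rpow (Or.inl (by linarith))]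
      rw [show α - 1 + 1 = α by ring, Real.one_rpow, Real.zero_rpow hα.ne']
      ring
    linarith
  have e : ∫ t in Ioi (1 : ℝ), Real.exp (-(c * t)) * t ^ (α - 1) =
      ∫ t in Ioi (1 : ℝ), t ^ (α - 1) * Real.exp (-(c * t)) :=
    setIntegral_congr_fun measurableSet_Ioi fun t _ => mul_comm _ _
  rw [e]
  linarith

/-- The `t^{−α}`-piece, cut at `T = 1/c ≥ 1`: `∫₁^∞ e^{−ct} t^{−α} dt ≥ e^{−1}((1/c)^{1−α} − 1)/(1 − α)`
(`0 < c ≤ 1`, `0 ≤ α < 1`). [folklore] -/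
private theorem integral_Ioi_one_exp_mul_rpow_neg_ge {c α : ℝ} (hc : 0 < c) (hc1 : c ≤ 1) (hα0 : 0 ≤ α)
    (hα1 : α < 1) :
    Real.exp (-1) * (((1 / c) ^ (1 - α) - 1) / (1 - α)) ≤
      ∫ t in Ioi (1 : ℝ), Real.exp (-(c * t)) * t ^ (-α) := by
  set T : ℝ := 1 / c with hT
  have hT1 : 1 ≤ T := by rw [hT, le_div_iff₀ hc]; linarith
  have hT0 : 0 < T := by positivity
  -- integrability on `(1, ∞)`: dominated by `e^{−ct}`
  have hexpint : IntegrableOn (fun t : ℝ => Real.exp (-(c * t))) (Ioi 1) := by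
    have := exp_neg_integrableOn_Ioi 1 hc
    refine this.congr_fun (fun t _ => by ring_nf) measurableSet_Ioi
  have hmeas : AEStronglyMeasurable (fun t : ℝ => Real.exp (-(c * t)) * t ^ (-α))
      (volume.restrict (Ioi (1 : ℝ))) :=
    (ContinuousOn.mul (by fun_prop)
      (continuousOn_id.rpow_const fun t ht => Or.inl (zero_lt_one.trans ht).ne')).aestronglyMeasurable
      measurableSet_Ioi
  have hint : IntegrableOn (fun t : ℝ => Real.exp (-(c * t)) * t ^ (-α)) (Ioi 1) := by
    refine Integrable.mono' hexpint hmeas ?_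
    filter_upwards [self_mem_ae_restrict measurableSet_Ioi] with t ht
    have ht : (1 : ℝ) < t := ht
    have hle : t ^ (-α) ≤ 1 := Real.rpow_le_one_of_one_le_of_nonpos ht.le (by linarith)
    have h0 : 0 ≤ t ^ (-α) := Real.rpow_nonneg (zero_le_one.trans ht.le) _
    rw [Real.norm_of_nonneg (mul_nonneg (Real.exp_pos _).le h0)]
    calc Real.exp (-(c * t)) * t ^ (-α) ≤ Real.exp (-(c * t)) * 1 :=
          mul_le_mul_of_nonneg_left hle (Real.exp_pos _).le
      _ = Real.exp (-(c * t)) := mul_one _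
  -- restrict to `(1, T]`
  have hsub : ∫ t in Ioc (1 : ℝ) T, Real.exp (-(c * t)) * t ^ (-α) ≤
      ∫ t in Ioi (1 : ℝ), Real.exp (-(c * t)) * t ^ (-α) := by
    refine setIntegral_mono_set hint ?_ Ioc_subset_Ioi_self.eventuallyLE
    filter_upwards [self_mem_ae_restrict measurableSet_Ioi] with t ht
    have ht : (1 : ℝ) < t := ht
    exact mul_nonneg (Real.exp_pos _).le (Real.rpow_nonneg (zero_le_one.trans ht.le) _)
  -- on `(1, T]`: `e^{−ct} ≥ e^{−1}`
  have hcont : ContinuousOn (fun t : ℝ => Real.exp (-1) * t ^ (-α)) (Icc 1 T) :=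
    continuousOn_const.mul (continuousOn_id.rpow_const fun t ht =>
      Or.inl (lt_of_lt_of_le zero_lt_one ht.1).ne')
  have hlow : ∫ t in Ioc (1 : ℝ) T, Real.exp (-1) * t ^ (-α) ≤
      ∫ t in Ioc (1 : ℝ) T, Real.exp (-(c * t)) * t ^ (-α) := by
    refine setIntegral_mono_on (hcont.integrableOn_Icc.mono_set Ioc_subset_Icc_self)
      (hint.mono_set Ioc_subset_Ioi_self) measurableSet_Ioc fun t ht => ?_
    have h0 : 0 ≤ t ^ (-α) := Real.rpow_nonneg (by linarith [ht.1]) _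
    refine mul_le_mul_of_nonneg_right (Real.exp_le_exp.2 ?_) h0
    have : c * t ≤ c * T := mul_le_mul_of_nonneg_left ht.2 hc.le
    have hcT : c * T = 1 := by rw [hT]; field_simp
    linarith
  have hval : ∫ t in Ioc (1 : ℝ) T, Real.exp (-1) * t ^ (-α) =
      Real.exp (-1) * ((T ^ (1 - α) - 1) / (1 - α)) := by
    rw [← intervalIntegral.integral_of_le hT1, intervalIntegral.integral_const_mul,
      integral_rpow (Or.inl (by linarith)), Real.one_rpow, show -α + 1 = 1 - α by ring]
  rw [hval] at hlow
  exact hlow.trans hsub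


/-- Integrability of `t ↦ e^{−ct} t^{p}` on `(1, ∞)` for `c > 0`, `p ≤ 0` (dominated by `e^{−ct}`).
[folklore] -/
private theorem integrableOn_exp_mul_rpow_Ioi_one {c p : ℝ} (hc : 0 < c) (hp : p ≤ 0) :
    IntegrableOn (fun t : ℝ => Real.exp (-(c * t)) * t ^ p) (Ioi 1) := by
  have hexpint : IntegrableOn (fun t : ℝ => Real.exp (-(c * t))) (Ioi 1) := by
    have := exp_neg_integrableOn_Ioi 1 hc
    refine this.congr_fun (fun t _ => by ring_nf) measurableSet_Ioi
  have hmeas : AEStronglyMeasurable (fun t : ℝ => Real.exp (-(c * t)) * t ^ p)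
      (volume.restrict (Ioi (1 : ℝ))) :=
    (ContinuousOn.mul (by fun_prop)
      (continuousOn_id.rpow_const fun t ht => Or.inl (zero_lt_one.trans ht).ne')).aestronglyMeasurable
      measurableSet_Ioi
  refine Integrable.mono' hexpint hmeas ?_
  filter_upwards [self_mem_ae_restrict measurableSet_Ioi] with t ht
  have ht : (1 : ℝ) < t := ht
  have hle : t ^ p ≤ 1 := Real.rpow_le_one_of_one_le_of_nonpos ht.le hp
  have h0 : 0 ≤ t ^ p := Real.rpow_nonneg (zero_le_one.trans ht.le) _
  rw [Real.norm_of_nonneg (mul_nonneg (Real.exp_pos _).le h0)]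
  calc Real.exp (-(c * t)) * t ^ p ≤ Real.exp (-(c * t)) * 1 :=
        mul_le_mul_of_nonneg_left hle (Real.exp_pos _).le
    _ = Real.exp (-(c * t)) := mul_one _

/-- **The explicit lower bound for the minorant**: for `0 < c ≤ 1` and `0 < δ < 1`, `α = 1 − δ`,
`∫₁^∞ e^{−ct}(t^{α−1} + t^{−α}) dt ≥ (1/c)^α Γ(α) − 1/α + e^{−1}((1/c)^δ − 1)/δ`. [folklore] -/
private theorem minorant_integral_ge {c δ : ℝ} (hc : 0 < c) (hc1 : c ≤ 1) (hδ0 : 0 < δ) (hδ1 : δ < 1) :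
    (1 / c) ^ (1 - δ) * Real.Gamma (1 - δ) - 1 / (1 - δ) + Real.exp (-1) * (((1 / c) ^ δ - 1) / δ) ≤
      ∫ t in Ioi (1 : ℝ), Real.exp (-(c * t)) * (t ^ ((1 - δ) - 1) + t ^ (-(1 - δ))) := by
  have h1 := integral_Ioi_one_exp_mul_rpow_ge hc (by linarith : 0 < 1 - δ)
  have h2 := integral_Ioi_one_exp_mul_rpow_neg_ge hc hc1 (by linarith : 0 ≤ 1 - δ) (by linarith : 1 - δ < 1)
  rw [show 1 - (1 - δ) = δ by ring] at h2
  have hi1 := integrableOn_exp_mul_rpow_Ioi_one hc (by linarith : (1 - δ) - 1 ≤ 0)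
  have hi2 := integrableOn_exp_mul_rpow_Ioi_one hc (by linarith : -(1 - δ) ≤ 0)
  have e : ∫ t in Ioi (1 : ℝ), Real.exp (-(c * t)) * (t ^ ((1 - δ) - 1) + t ^ (-(1 - δ))) =
      (∫ t in Ioi (1 : ℝ), Real.exp (-(c * t)) * t ^ ((1 - δ) - 1)) +
        ∫ t in Ioi (1 : ℝ), Real.exp (-(c * t)) * t ^ (-(1 - δ)) := by
    rw [← integral_add hi1 hi2]
    exact setIntegral_congr_fun measurableSet_Ioi fun t _ => by ring
  rw [e]
  linarith

/-- `(√d)^{2/log d} = e`. [folklore] -/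
private theorem sqrt_rpow_two_div_log {d : ℝ} (hd : 1 < d) :
    Real.sqrt d ^ (2 / Real.log d) = Real.exp 1 := by
  have hd0 : 0 < d := by linarith
  have hlog : 0 < Real.log d := Real.log_pos hd
  rw [Real.rpow_def_of_pos (Real.sqrt_pos.2 hd0), Real.log_sqrt hd0.le]
  congr 1
  field_simp

/-- **The lower bound for `h(−d)` with the printed choice `α = 1 − 2/log d`, in closed form.** For the
odd real primitive character `χ` mod `d ≥ 40` without real zeros of `L(s, χ)` in `(1 − 2/log d, 1)`,
writing `δ = 2/log d` and `R = (2/(πe))√d/log d`: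
`h(−d) ≥ R·(1−δ)(2π)^δ Γ(1−δ) − 2δ + 2(1−δ)((2π)^{−δ} − e^{−1})`
(from `classNumber_ge_integral` and `minorant_integral_ge` with `c = 2π/√d`, using
`(√d)^{δ} = e`). [cite: Oesterle1988Gauss, II §3, proof of the Proposition pp. 58–59] -/
theorem classNumber_ge_closedForm {d : ℕ} [NeZero d] (hd : 40 ≤ d)
    {χ : DirichletCharacter ℂ d} (hprim : χ.IsPrimitive) (hquad : χ.IsQuadratic) (hodd : χ.Odd)
    (hL : ∀ σ : ℝ, 1 - 2 / Real.log d < σ → σ < 1 → χ.LFunction σ ≠ 0)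
    {δ : ℝ} (hδ : δ = 2 / Real.log d) :
    (2 / (Real.pi * Real.exp 1) * Real.sqrt d / Real.log d) * ((1 - δ) * (2 * Real.pi) ^ δ * Real.Gamma (1 - δ))
      - 2 * δ + 2 * (1 - δ) * ((2 * Real.pi) ^ (-δ) - Real.exp (-1)) ≤ (classNumber (-(d : ℤ)) : ℝ) := by
  have hd4 : 4 < d := by omega
  have hdR : (40 : ℝ) ≤ d := by exact_mod_cast hd
  have hd1 : (1 : ℝ) < d := by linarith
  have hd0 : (0 : ℝ) < d := by linarith
  -- `log d > 2`
  have hlog2 : 2 < Real.log d := by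
    rw [Real.lt_log_iff_exp_lt hd0]
    have h1 := Real.exp_one_lt_d9
    have h0 := Real.exp_pos 1
    have : Real.exp 2 = Real.exp 1 ^ 2 := by rw [← Real.exp_nat_mul]; norm_num
    rw [this]
    nlinarith
  have hlog0 : 0 < Real.log d := by linarith
  have hδ0 : 0 < δ := by rw [hδ]; positivity
  have hδ1 : δ < 1 := by rw [hδ, div_lt_one hlog0]; linarith
  set s : ℝ := Real.sqrt d with hs
  have hs0 : 0 < s := Real.sqrt_pos.2 hd0
  have hsδ : s ^ δ = Real.exp 1 := by rw [hδ]; exact sqrt_rpow_two_div_log hd1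
  -- `c = 2π/√d ≤ 1`
  set c : ℝ := 2 * Real.pi / s with hcdef
  have hπ := Real.pi_pos
  have hπ3 := Real.pi_lt_d6
  have hc0 : 0 < c := by positivity
  have h2π : 0 < 2 * Real.pi := by positivity
  have hπsq : Real.pi ^ 2 < 10 := by nlinarith [hπ3, hπ]
  have h2πs : 2 * Real.pi ≤ s := by
    rw [hs]
    refine (Real.le_sqrt' h2π).2 ?_
    nlinarith
  have hc1 : c ≤ 1 := by rw [hcdef, div_le_one hs0]; exact h2πs
  -- the displayed inequality with `α = 1 − δ`
  have hmain := classNumber_ge_integral hd4 hprim hquad hodd (α := 1 - δ) (by linarith) (by linarith)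
    (fun σ h1 h2 => hL σ (by rw [hδ] at h1; linarith) h2)
  have hmin := minorant_integral_ge hc0 hc1 hδ0 hδ1
  have e1 : (fun t : ℝ => Real.exp (-(2 * Real.pi * t / Real.sqrt d)) * (t ^ ((1 - δ) - 1) + t ^ (-(1 - δ)))) =
      fun t : ℝ => Real.exp (-(c * t)) * (t ^ ((1 - δ) - 1) + t ^ (-(1 - δ))) := by
    funext t; rw [hcdef, hs]; congr 2; ring
  rw [e1] at hmain
  -- rewrite the powers of `1/c = √d/(2π)`
  have h1c : 1 / c = s / (2 * Real.pi) := by rw [hcdef]; field_simp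
  have hpow1 : (1 / c) ^ δ = Real.exp 1 * (2 * Real.pi) ^ (-δ) := by
    rw [h1c, Real.div_rpow hs0.le h2π.le, hsδ, Real.rpow_neg h2π.le, div_eq_mul_inv]
  have hpow2 : (1 / c) ^ (1 - δ) = s / (2 * Real.pi) * (Real.exp (-1) * (2 * Real.pi) ^ δ) := by
    have hsp : 0 < s / (2 * Real.pi) := by positivity
    rw [h1c, Real.rpow_sub hsp, Real.rpow_one, Real.div_rpow hs0.le h2π.le, hsδ, Real.exp_neg]
    field_simp
  rw [hpow1, hpow2] at hmin
  -- combine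
  have hαδ : 0 < 2 * (1 - δ) * δ := by nlinarith
  have hstep : 2 * (1 - δ) * δ *
      (s / (2 * Real.pi) * (Real.exp (-1) * (2 * Real.pi) ^ δ) * Real.Gamma (1 - δ) - 1 / (1 - δ) +
        Real.exp (-1) * ((Real.exp 1 * (2 * Real.pi) ^ (-δ) - 1) / δ)) ≤ (classNumber (-(d : ℤ)) : ℝ) := by
    have := mul_le_mul_of_nonneg_left hmin hαδ.le
    have e2 : 2 * (1 - δ) * (1 - (1 - δ)) = 2 * (1 - δ) * δ := by ring
    rw [e2] at hmain
    linarith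
  -- algebra: the left side equals the closed form
  have hE : Real.exp (-1) * Real.exp 1 = 1 := by rw [← Real.exp_add]; norm_num
  have hlogδ : Real.log d = 2 / δ := by rw [hδ]; field_simp
  have hδne : δ ≠ 0 := hδ0.ne'
  have h1δ : (1 - δ) ≠ 0 := by linarith
  have hExp : Real.exp 1 ≠ 0 := (Real.exp_pos 1).ne'
  have key : 2 * (1 - δ) * δ *
      (s / (2 * Real.pi) * (Real.exp (-1) * (2 * Real.pi) ^ δ) * Real.Gamma (1 - δ) - 1 / (1 - δ) +
        Real.exp (-1) * ((Real.exp 1 * (2 * Real.pi) ^ (-δ) - 1) / δ)) =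
      (2 / (Real.pi * Real.exp 1) * s / Real.log d) * ((1 - δ) * (2 * Real.pi) ^ δ * Real.Gamma (1 - δ))
      - 2 * δ + 2 * (1 - δ) * ((2 * Real.pi) ^ (-δ) - Real.exp (-1)) := by
    rw [hlogδ, Real.exp_neg]
    field_simp
  rw [key] at hstep
  rw [hs] at hstep
  exact hstep

end Explicit


/-! ## Numerical constants (powers of `2π`, `e`) -/

section Numerics

/-- `6.283184 ≤ 2π ≤ 6.283186`. [folklore] -/
private theorem two_pi_bounds : (6.283184 : ℝ) ≤ 2 * Real.pi ∧ 2 * Real.pi ≤ 6.283186 := by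
  constructor <;> nlinarith [Real.pi_gt_d6, Real.pi_lt_d6]

/-- `(2π)^{1/4} ≥ 1.5832`. [folklore] -/
private theorem rpow_two_pi_quarter_ge : (1.5832 : ℝ) ≤ (2 * Real.pi) ^ ((1 : ℝ) / 4) := by
  have h : (1.5832 : ℝ) ^ 4 ≤ 2 * Real.pi := by nlinarith [two_pi_bounds.1]
  calc (1.5832 : ℝ) = ((1.5832 : ℝ) ^ 4) ^ ((1 : ℝ) / 4) := by
        rw [show ((1 : ℝ) / 4) = ((4 : ℕ) : ℝ)⁻¹ by norm_num,
          Real.pow_rpow_inv_natCast (by norm_num) (by norm_num)]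
    _ ≤ (2 * Real.pi) ^ ((1 : ℝ) / 4) := Real.rpow_le_rpow (by positivity) h (by norm_num)

/-- `(2π)^{2/9} ≥ 1.504`. [folklore] -/
private theorem rpow_two_pi_two_ninths_ge : (1.504 : ℝ) ≤ (2 * Real.pi) ^ ((2 : ℝ) / 9) := by
  have h : (1.504 : ℝ) ^ 9 ≤ (2 * Real.pi) ^ 2 := by nlinarith [two_pi_bounds.1]
  have h2π : (0 : ℝ) ≤ 2 * Real.pi := by positivity
  calc (1.504 : ℝ) = ((1.504 : ℝ) ^ 9) ^ ((1 : ℝ) / 9) := by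
        rw [show ((1 : ℝ) / 9) = ((9 : ℕ) : ℝ)⁻¹ by norm_num,
          Real.pow_rpow_inv_natCast (by norm_num) (by norm_num)]
    _ ≤ ((2 * Real.pi) ^ 2) ^ ((1 : ℝ) / 9) := Real.rpow_le_rpow (by positivity) h (by norm_num)
    _ = (2 * Real.pi) ^ ((2 : ℝ) / 9) := by
        rw [show ((2 * Real.pi) ^ 2 : ℝ) = (2 * Real.pi) ^ (2 : ℝ) by norm_cast, ← Real.rpow_mul h2π]
        norm_num

/-- `(2π)^{−1/4} ≥ 0.6316`. [folklore] -/
private theorem rpow_two_pi_neg_quarter_ge : (0.6316 : ℝ) ≤ (2 * Real.pi) ^ (-((1 : ℝ) / 4)) := by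
  have h2π : (0 : ℝ) ≤ 2 * Real.pi := by positivity
  have h : 2 * Real.pi ≤ ((1 : ℝ) / 0.6316) ^ 4 := by nlinarith [two_pi_bounds.2]
  have hup : (2 * Real.pi) ^ ((1 : ℝ) / 4) ≤ (1 : ℝ) / 0.6316 := by
    calc (2 * Real.pi) ^ ((1 : ℝ) / 4) ≤ (((1 : ℝ) / 0.6316) ^ 4) ^ ((1 : ℝ) / 4) :=
          Real.rpow_le_rpow h2π h (by norm_num)
      _ = (1 : ℝ) / 0.6316 := by
          rw [show ((1 : ℝ) / 4) = ((4 : ℕ) : ℝ)⁻¹ by norm_num,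
            Real.pow_rpow_inv_natCast (by norm_num) (by norm_num)]
  have hpos : 0 < (2 * Real.pi) ^ ((1 : ℝ) / 4) := Real.rpow_pos_of_pos (by positivity) _
  rw [Real.rpow_neg h2π]
  calc (0.6316 : ℝ) = ((1 : ℝ) / 0.6316)⁻¹ := by norm_num
    _ ≤ ((2 * Real.pi) ^ ((1 : ℝ) / 4))⁻¹ := inv_anti₀ hpos hup

/-- `(2π)^{−4/15} ≥ 0.6125`. [folklore] -/
private theorem rpow_two_pi_neg_four_fifteenths_ge : (0.6125 : ℝ) ≤ (2 * Real.pi) ^ (-((4 : ℝ) / 15)) := by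
  have h2π : (0 : ℝ) ≤ 2 * Real.pi := by positivity
  have h4 : (2 * Real.pi) ^ 4 ≤ ((80 : ℝ) / 49) ^ 15 := by
    have := two_pi_bounds.2
    have h0 : (0 : ℝ) ≤ 2 * Real.pi := h2π
    calc (2 * Real.pi) ^ 4 ≤ (6.283186 : ℝ) ^ 4 := by gcongr
      _ ≤ ((80 : ℝ) / 49) ^ 15 := by norm_num
  have hup : (2 * Real.pi) ^ ((4 : ℝ) / 15) ≤ (80 : ℝ) / 49 := by
    calc (2 * Real.pi) ^ ((4 : ℝ) / 15) = ((2 * Real.pi) ^ (4 : ℝ)) ^ ((1 : ℝ) / 15) := by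
          rw [← Real.rpow_mul h2π]; norm_num
      _ = ((2 * Real.pi) ^ 4) ^ ((1 : ℝ) / 15) := by norm_cast
      _ ≤ ((((80 : ℝ) / 49)) ^ 15) ^ ((1 : ℝ) / 15) := Real.rpow_le_rpow (by positivity) h4 (by norm_num)
      _ = (80 : ℝ) / 49 := by
          rw [show ((1 : ℝ) / 15) = ((15 : ℕ) : ℝ)⁻¹ by norm_num,
            Real.pow_rpow_inv_natCast (by norm_num) (by norm_num)]
  have hpos : 0 < (2 * Real.pi) ^ ((4 : ℝ) / 15) := Real.rpow_pos_of_pos (by positivity) _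
  rw [Real.rpow_neg h2π]
  calc (0.6125 : ℝ) = ((80 : ℝ) / 49)⁻¹ := by norm_num
    _ ≤ ((2 * Real.pi) ^ ((4 : ℝ) / 15))⁻¹ := inv_anti₀ hpos hup

/-- `(2π)^{−2/9} ≥ 0.6646`. [folklore] -/
private theorem rpow_two_pi_neg_two_ninths_ge : (0.6646 : ℝ) ≤ (2 * Real.pi) ^ (-((2 : ℝ) / 9)) := by
  have h2π : (0 : ℝ) ≤ 2 * Real.pi := by positivity
  have h2 : (2 * Real.pi) ^ 2 ≤ ((1 : ℝ) / 0.6646) ^ 9 := by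
    calc (2 * Real.pi) ^ 2 ≤ (6.283186 : ℝ) ^ 2 := by gcongr; exact two_pi_bounds.2
      _ ≤ ((1 : ℝ) / 0.6646) ^ 9 := by norm_num
  have hup : (2 * Real.pi) ^ ((2 : ℝ) / 9) ≤ (1 : ℝ) / 0.6646 := by
    calc (2 * Real.pi) ^ ((2 : ℝ) / 9) = ((2 * Real.pi) ^ (2 : ℝ)) ^ ((1 : ℝ) / 9) := by
          rw [← Real.rpow_mul h2π]; norm_num
      _ = ((2 * Real.pi) ^ 2) ^ ((1 : ℝ) / 9) := by norm_cast
      _ ≤ ((((1 : ℝ) / 0.6646)) ^ 9) ^ ((1 : ℝ) / 9) := Real.rpow_le_rpow (by positivity) h2 (by norm_num)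
      _ = (1 : ℝ) / 0.6646 := by
          rw [show ((1 : ℝ) / 9) = ((9 : ℕ) : ℝ)⁻¹ by norm_num,
            Real.pow_rpow_inv_natCast (by norm_num) (by norm_num)]
  have hpos : 0 < (2 * Real.pi) ^ ((2 : ℝ) / 9) := Real.rpow_pos_of_pos (by positivity) _
  rw [Real.rpow_neg h2π]
  calc (0.6646 : ℝ) = ((1 : ℝ) / 0.6646)⁻¹ := by norm_num
    _ ≤ ((2 * Real.pi) ^ ((2 : ℝ) / 9))⁻¹ := inv_anti₀ hpos hup

/-- `e^{−1} ≤ 0.36788`. [folklore] -/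
private theorem exp_neg_one_le : Real.exp (-1) ≤ (0.36788 : ℝ) := by
  rw [Real.exp_neg]
  have h := Real.exp_one_gt_d9
  calc (Real.exp 1)⁻¹ ≤ (2.7182818283 : ℝ)⁻¹ := inv_anti₀ (by norm_num) h.le
    _ ≤ 0.36788 := by norm_num

/-- `0.23419 ≤ 2/(πe) ≤ 0.23421`. [folklore] -/
private theorem two_div_pi_mul_exp_one_bounds :
    (0.23419 : ℝ) ≤ 2 / (Real.pi * Real.exp 1) ∧ 2 / (Real.pi * Real.exp 1) ≤ 0.23421 := by
  have h1 := Real.exp_one_gt_d9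
  have h2 := Real.exp_one_lt_d9
  have h3 := Real.pi_gt_d6
  have h4 := Real.pi_lt_d6
  have hpos : 0 < Real.pi * Real.exp 1 := by positivity
  constructor
  · rw [le_div_iff₀ hpos]; nlinarith
  · rw [div_le_iff₀ hpos]; nlinarith

/-- `log(2π) ≥ 3/2` (`e³ < 21 < (2π)²`). [folklore] -/
private theorem three_halves_le_log_two_pi : (3 : ℝ) / 2 ≤ Real.log (2 * Real.pi) := by
  have h2π : (0 : ℝ) < 2 * Real.pi := by positivity
  rw [Real.le_log_iff_exp_le h2π]
  have h3 : Real.exp 3 < 21 := by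
    have : Real.exp 3 = Real.exp 1 ^ 3 := by rw [← Real.exp_nat_mul]; norm_num
    rw [this]
    have h := Real.exp_one_lt_d9
    have h0 := (Real.exp_pos 1).le
    calc Real.exp 1 ^ 3 < (2.7182818286 : ℝ) ^ 3 := by gcongr
      _ < 21 := by norm_num
  have hsq : Real.exp (3 / 2) ^ 2 < (2 * Real.pi) ^ 2 := by
    rw [← Real.exp_nat_mul]
    norm_num
    nlinarith [two_pi_bounds.1]
  exact (lt_of_pow_lt_pow_left₀ 2 h2π.le hsq).le

/-! ## The three bands of the final inequality

`Φ = R((1−δ)P Γ − 1) − 2δ + 2(1−δ)(Q − E) ≥ 0`, `P = (2π)^δ`, `Q = (2π)^{−δ}`, `E = e^{−1}`,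
`Γ = Γ(1−δ) ≥ 1`, `R = (2/(πe))√d/log d`. -/

/-- Band A (`1809 ≤ d ≤ 2980`, `1/4 < δ ≤ 4/15`). [folklore] -/
private theorem bandA {δ P Q G E R : ℝ} (hδ1 : 1 / 4 < δ) (hδ2 : δ ≤ 4 / 15) (hP : 1.5832 ≤ P)
    (hQ : 0.6125 ≤ Q) (hG : 1 ≤ G) (hE : E ≤ 0.36788) (hR : 1.245 ≤ R) :
    R ≤ R * ((1 - δ) * P * G) - 2 * δ + 2 * (1 - δ) * (Q - E) := by
  have hα : (11 : ℝ) / 15 ≤ 1 - δ := by linarith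
  have h1 : (11 : ℝ) / 15 * 1.5832 ≤ (1 - δ) * P := mul_le_mul hα hP (by norm_num) (by linarith)
  have h2 : (11 : ℝ) / 15 * 1.5832 * 1 ≤ (1 - δ) * P * G := mul_le_mul h1 hG (by norm_num) (by nlinarith)
  have h3 : 0 ≤ (1 - δ) * P * G - 1 := by linarith
  have h4 : 1.245 * ((1 - δ) * P * G - 1) ≤ R * ((1 - δ) * P * G - 1) := mul_le_mul_of_nonneg_right hR h3
  have h5 : (11 : ℝ) / 15 * (0.6125 - 0.36788) ≤ (1 - δ) * (Q - E) :=
    mul_le_mul hα (by linarith) (by norm_num) (by linarith)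
  nlinarith

/-- Band B (`2981 ≤ d ≤ 8103`, `2/9 ≤ δ ≤ 1/4`). [folklore] -/
private theorem bandB {δ P Q G E R : ℝ} (hδ2 : δ ≤ 1 / 4) (hP : 1.504 ≤ P)
    (hQ : 0.6316 ≤ Q) (hG : 1 ≤ G) (hE : E ≤ 0.36788) (hR : 1.42 ≤ R) :
    R ≤ R * ((1 - δ) * P * G) - 2 * δ + 2 * (1 - δ) * (Q - E) := by
  have hα : (3 : ℝ) / 4 ≤ 1 - δ := by linarith
  have h1 : (3 : ℝ) / 4 * 1.504 ≤ (1 - δ) * P := mul_le_mul hα hP (by norm_num) (by linarith)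
  have h2 : (3 : ℝ) / 4 * 1.504 * 1 ≤ (1 - δ) * P * G := mul_le_mul h1 hG (by norm_num) (by nlinarith)
  have h3 : 0 ≤ (1 - δ) * P * G - 1 := by linarith
  have h4 : 1.42 * ((1 - δ) * P * G - 1) ≤ R * ((1 - δ) * P * G - 1) := mul_le_mul_of_nonneg_right hR h3
  have h5 : (3 : ℝ) / 4 * (0.6316 - 0.36788) ≤ (1 - δ) * (Q - E) :=
    mul_le_mul hα (by linarith) (by norm_num) (by linarith)
  nlinarith

/-- Band C (`d ≥ 8104`, `0 < δ ≤ 2/9`); here `P ≥ 1 + (3/2)δ` suffices. [folklore] -/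
private theorem bandC {δ P Q G E R : ℝ} (hδ0 : 0 < δ) (hδ2 : δ ≤ 2 / 9) (hP : 1 + 3 / 2 * δ ≤ P)
    (hQ : 0.6646 ≤ Q) (hG : 1 ≤ G) (hE : E ≤ 0.36788) (hR : 0 ≤ R) :
    R ≤ R * ((1 - δ) * P * G) - 2 * δ + 2 * (1 - δ) * (Q - E) := by
  have hα : (7 : ℝ) / 9 ≤ 1 - δ := by linarith
  have h1 : (1 - δ) * (1 + 3 / 2 * δ) ≤ (1 - δ) * P := mul_le_mul_of_nonneg_left hP (by linarith)
  have h1' : 1 ≤ (1 - δ) * (1 + 3 / 2 * δ) := by nlinarith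
  have h2 : 1 * 1 ≤ (1 - δ) * P * G := mul_le_mul (by linarith) hG (by norm_num) (by nlinarith)
  have h3 : 0 ≤ (1 - δ) * P * G - 1 := by linarith
  have h4 : 0 ≤ R * ((1 - δ) * P * G - 1) := mul_nonneg hR h3
  have h5 : (7 : ℝ) / 9 * (0.6646 - 0.36788) ≤ (1 - δ) * (Q - E) :=
    mul_le_mul hα (by linarith) (by norm_num) (by linarith)
  nlinarith

end Numerics


/-! ## Thresholds in `d`, the small discriminants, and the theorem as printed -/

section Final

open Literature.NumberTheory.QuadraticFields.BinaryQuadraticForm (classNumber_pos two_le_classNumber_of_le)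
open Literature.NumberTheory.QuadraticFields.BinaryQuadraticForm.SmallRange (certOK two_le_classNumber_of_certOK)
open Literature.NumberTheory.LFunctions.PrimitiveQuadratic (isFundamentalDiscriminant_neg)

/-- `e^n = e·…·e`. [folklore] -/
private theorem exp_natCast_eq_pow (n : ℕ) : Real.exp n = Real.exp 1 ^ n := by
  rw [← Real.exp_nat_mul, mul_one]

/-- `e^n ≤ 2.7182818286^n`. [folklore] -/
private theorem exp_natCast_le (n : ℕ) : Real.exp n ≤ (2.7182818286 : ℝ) ^ n := by
  rw [exp_natCast_eq_pow]
  exact pow_le_pow_left₀ (Real.exp_pos 1).le Real.exp_one_lt_d9.le n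

/-- `2.7182818283^n ≤ e^n`. [folklore] -/
private theorem le_exp_natCast (n : ℕ) : (2.7182818283 : ℝ) ^ n ≤ Real.exp n := by
  rw [exp_natCast_eq_pow]
  exact pow_le_pow_left₀ (by norm_num) Real.exp_one_gt_d9.le n

/-- `y ≤ log d` from `e^{k} ≤ d^m` with `y = k/m`. [folklore] -/
private theorem le_log_of_exp_le_pow {d y : ℝ} (hd : 0 < d) {k m : ℕ} (hm : 0 < m) (hy : y * m = k)
    (h : Real.exp k ≤ d ^ m) : y ≤ Real.log d := by
  have h1 : (k : ℝ) ≤ Real.log (d ^ m) := (Real.le_log_iff_exp_le (by positivity)).2 h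
  rw [Real.log_pow] at h1
  have hm' : (0 : ℝ) < m := by exact_mod_cast hm
  nlinarith

/-- **`h(−d) ≥ 2` for the fundamental discriminants `−d` with `201 ≤ d ≤ 500000`**, by explicit
reduced forms: `(2, 1, (d+1)/8)` if `d ≡ 7 (8)`, `(2, 0, d/8)` if `d ≡ 8 (16)`, `(2, 2, (d+4)/8)` if
`d ≡ 4 (16)`, and the tree's kernel enumeration `two_le_classNumber_of_le` if `d ≡ 3 (8)` (no use of
the class number one theorem; the statement is a case of Cox, Thm. 7.30(ii): the discriminants of class
number one are the thirteen listed there, all `≥ −163`). [cite: Cox2013, §7.D Thm. 7.30(ii)] -/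
theorem two_le_classNumber_of_fundamental {d : ℕ} (h201 : 201 ≤ d) (hle : d ≤ 500000)
    (hfund : ((-(d : ℤ)) % 4 = 1 ∧ Squarefree (-(d : ℤ)) ∧ (-(d : ℤ)) ≠ 1) ∨
      (4 ∣ (-(d : ℤ)) ∧ ((-(d : ℤ)) / 4 % 4 = 2 ∨ (-(d : ℤ)) / 4 % 4 = 3) ∧
        Squarefree ((-(d : ℤ)) / 4))) :
    2 ≤ classNumber (-(d : ℤ)) := by
  rcases hfund with ⟨h1, -, -⟩ | ⟨h4, h23, -⟩
  · have h8 : d % 8 = 3 ∨ d % 8 = 7 := by omega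
    rcases h8 with h8 | h8
    · exact two_le_classNumber_of_le h8 hle (by
        simp only [Finset.mem_insert, Finset.mem_singleton]; omega)
    · refine two_le_classNumber_of_certOK (n := d) (a := 2) (b := 1) (by omega) (by norm_num)
        (by norm_num) ?_
      simp only [certOK, Bool.and_eq_true, beq_iff_eq, Nat.ble_eq]
      refine ⟨⟨by omega, by omega⟩, ?_⟩
      simp only [Nat.gcd_one_right, Nat.gcd_one_left]
  · have h16 : d % 16 = 8 ∨ d % 16 = 4 := by omega
    rcases h16 with h16 | h16
    · refine two_le_classNumber_of_certOK (n := d) (a := 2) (b := 0) (by omega) (by norm_num)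
        (by norm_num) ?_
      simp only [certOK, Bool.and_eq_true, beq_iff_eq, Nat.ble_eq]
      refine ⟨⟨by omega, by omega⟩, ?_⟩
      have hodd : (0 * 0 + d) / (4 * 2) % 2 = 1 := by omega
      rw [Nat.gcd_zero_right]
      exact Nat.coprime_two_left.2 (Nat.odd_iff.2 hodd)
    · refine two_le_classNumber_of_certOK (n := d) (a := 2) (b := 2) (by omega) (by norm_num)
        (by norm_num) ?_
      simp only [certOK, Bool.and_eq_true, beq_iff_eq, Nat.ble_eq]
      refine ⟨⟨by omega, by omega⟩, ?_⟩
      have hodd : (2 * 2 + d) / (4 * 2) % 2 = 1 := by omega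
      rw [Nat.gcd_self]
      exact Nat.coprime_two_left.2 (Nat.odd_iff.2 hodd)

/-- **Oesterlé 1988, II §3, Proposition (Hecke–Landau, explicit) — AS PRINTED (28).** Let `d > 4`
and let `χ` be the odd real primitive Dirichlet character mod `d` (so `−d` is a fundamental
discriminant, `K = ℚ(√−d)` has `ζ_K = ζ·L(·, χ)`, and `h(−d)` — the number of reduced primitive
positive definite forms of discriminant `−d` — is the class number of `K`). If `ζ_K` has no real
zero in `(1 − 2/log d, 1)`, i.e. (`ζ(σ) < 0` on `(0, 1)`) `L(σ, χ) ≠ 0` for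
`1 − 2/log d < σ < 1`, then
`h(−d) ≥ (2/(πe)) · √d / log d`.
Proof as printed (class-by-class positivity of the theta integral, `α = 1 − 2/log d`) for `d ≥ 1809`
(`classNumber_ge_closedForm` and the bands `bandA`/`bandB`/`bandC`); for `d ≤ 1808` the right side is
`≤ 2` (resp. `≤ 1` for `d ≤ 200`) and `h(−d) ≥ 2` by explicit reduced forms (resp. `≥ 1`), where the
source appeals to the tables («majoré par 1 pour `d < 800`, par 2 pour `d ≤ 5000`, par 3 pour
`d ≤ 15000`»). [cite: Oesterle1988Gauss, II §3 Proposition p. 58 (28)] -/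
theorem classNumber_ge_oesterle {d : ℕ} [NeZero d] (hd : 4 < d)
    {χ : DirichletCharacter ℂ d} (hprim : χ.IsPrimitive) (hquad : χ.IsQuadratic) (hodd : χ.Odd)
    (hL : ∀ σ : ℝ, 1 - 2 / Real.log d < σ → σ < 1 → χ.LFunction σ ≠ 0) :
    2 / (Real.pi * Real.exp 1) * Real.sqrt d / Real.log d ≤ (classNumber (-(d : ℤ)) : ℝ) := by
  have hd0 : (0 : ℝ) < d := by exact_mod_cast (by omega : 0 < d)
  have hd5 : (5 : ℝ) ≤ d := by exact_mod_cast (by omega : 5 ≤ d)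
  have hfund := isFundamentalDiscriminant_neg hprim hquad hodd
  have hD0 : (-(d : ℤ)) < 0 := by omega
  have h4 : (-(d : ℤ)) % 4 = 0 ∨ (-(d : ℤ)) % 4 = 1 := by
    rcases hfund with ⟨h1, -, -⟩ | ⟨h0, -, -⟩
    · exact Or.inr h1
    · exact Or.inl (Int.emod_eq_zero_of_dvd h0)
  have hh1 : (1 : ℝ) ≤ classNumber (-(d : ℤ)) := by exact_mod_cast classNumber_pos hD0 h4
  obtain ⟨hK1, hK2⟩ := two_div_pi_mul_exp_one_bounds
  set K : ℝ := 2 / (Real.pi * Real.exp 1) with hKdef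
  have hK0 : 0 < K := by linarith
  have hsd0 : 0 < Real.sqrt d := Real.sqrt_pos.2 hd0
  -- log d ≥ 8/5 (for all d ≥ 5)
  have hlog16 : (8 : ℝ) / 5 ≤ Real.log d := by
    refine le_log_of_exp_le_pow hd0 (k := 8) (m := 5) (by norm_num) (by norm_num) ?_
    calc Real.exp (8 : ℕ) ≤ (2.7182818286 : ℝ) ^ 8 := exp_natCast_le 8
      _ ≤ 5 ^ 5 := by norm_num
      _ ≤ (d : ℝ) ^ 5 := by gcongr
  have hlog0 : 0 < Real.log d := by linarith
  -- the bound `K√d/log d ≤ B` from `K ≤ 0.23421`, `√d ≤ m`, `L ≤ log d`, `0.23421·m ≤ B·L`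
  have hRle : ∀ {m L B : ℝ}, Real.sqrt d ≤ m → L ≤ Real.log d → 0 < L → 0.23421 * m ≤ B * L →
      K * Real.sqrt d / Real.log d ≤ B := by
    intro m L B hm hL hL0 hB
    rw [div_le_iff₀ hlog0]
    have : K * Real.sqrt d ≤ 0.23421 * m := mul_le_mul hK2 hm hsd0.le (by norm_num)
    have hB0 : 0 ≤ B := by
      have : 0 ≤ 0.23421 * m := by nlinarith
      nlinarith
    nlinarith
  by_cases h200 : d ≤ 200
  · -- `R ≤ 1 ≤ h(−d)`
    refine le_trans ?_ hh1
    by_cases h20 : d ≤ 20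
    · have hm : Real.sqrt d ≤ 4.48 := Real.sqrt_le_iff.2 ⟨by norm_num, by
        have : (d : ℝ) ≤ 20 := by exact_mod_cast h20
        nlinarith⟩
      exact hRle hm hlog16 (by norm_num) (by norm_num)
    by_cases h100 : d ≤ 100
    · have hm : Real.sqrt d ≤ 10 := Real.sqrt_le_iff.2 ⟨by norm_num, by
        have : (d : ℝ) ≤ 100 := by exact_mod_cast h100
        nlinarith⟩
      have hlog3 : (3 : ℝ) ≤ Real.log d := by
        refine le_log_of_exp_le_pow hd0 (k := 3) (m := 1) (by norm_num) (by norm_num) ?_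
        calc Real.exp (3 : ℕ) ≤ (2.7182818286 : ℝ) ^ 3 := exp_natCast_le 3
          _ ≤ 21 := by norm_num
          _ ≤ (d : ℝ) ^ 1 := by rw [pow_one]; exact_mod_cast (by omega : 21 ≤ d)
      exact hRle hm hlog3 (by norm_num) (by norm_num)
    · have hm : Real.sqrt d ≤ 14.15 := Real.sqrt_le_iff.2 ⟨by norm_num, by
        have : (d : ℝ) ≤ 200 := by exact_mod_cast h200
        nlinarith⟩
      have hlog45 : (9 : ℝ) / 2 ≤ Real.log d := by
        refine le_log_of_exp_le_pow hd0 (k := 9) (m := 2) (by norm_num) (by norm_num) ?_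
        calc Real.exp (9 : ℕ) ≤ (2.7182818286 : ℝ) ^ 9 := exp_natCast_le 9
          _ ≤ 101 ^ 2 := by norm_num
          _ ≤ (d : ℝ) ^ 2 := by
              have : (101 : ℝ) ≤ d := by exact_mod_cast (by omega : 101 ≤ d)
              gcongr
      exact hRle hm hlog45 (by norm_num) (by norm_num)
  by_cases h1808 : d ≤ 1808
  · -- `R ≤ 2 ≤ h(−d)`
    have hh2 : (2 : ℝ) ≤ classNumber (-(d : ℤ)) := by
      exact_mod_cast two_le_classNumber_of_fundamental (by omega) (by omega) hfund
    refine le_trans ?_ hh2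
    have hm : Real.sqrt d ≤ 42.53 := Real.sqrt_le_iff.2 ⟨by norm_num, by
      have : (d : ℝ) ≤ 1808 := by exact_mod_cast h1808
      nlinarith⟩
    have hlog : (21 : ℝ) / 4 ≤ Real.log d := by
      refine le_log_of_exp_le_pow hd0 (k := 21) (m := 4) (by norm_num) (by norm_num) ?_
      calc Real.exp (21 : ℕ) ≤ (2.7182818286 : ℝ) ^ 21 := exp_natCast_le 21
        _ ≤ 201 ^ 4 := by norm_num
        _ ≤ (d : ℝ) ^ 4 := by
            have : (201 : ℝ) ≤ d := by exact_mod_cast (by omega : 201 ≤ d)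
            gcongr
    exact hRle hm hlog (by norm_num) (by norm_num)
  -- `d ≥ 1809`: the analytic bound
  push Not at h200 h1808
  have hcf := classNumber_ge_closedForm (by omega : 40 ≤ d) hprim hquad hodd hL rfl
  set δ : ℝ := 2 / Real.log d with hδdef
  have h2π1 : (1 : ℝ) ≤ 2 * Real.pi := by linarith [two_pi_bounds.1]
  have h2π0 : (0 : ℝ) < 2 * Real.pi := by linarith
  -- `log d ≥ 15/2`, so `δ ≤ 4/15`, `0 < δ`, `Γ(1−δ) ≥ 1`
  have hlog75 : (15 : ℝ) / 2 ≤ Real.log d := by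
    refine le_log_of_exp_le_pow hd0 (k := 15) (m := 2) (by norm_num) (by norm_num) ?_
    calc Real.exp (15 : ℕ) ≤ (2.7182818286 : ℝ) ^ 15 := exp_natCast_le 15
      _ ≤ 1809 ^ 2 := by norm_num
      _ ≤ (d : ℝ) ^ 2 := by
          have : (1809 : ℝ) ≤ d := by exact_mod_cast h1808
          gcongr
  have hδ0 : 0 < δ := by positivity
  have hδ415 : δ ≤ 4 / 15 := by
    rw [hδdef, div_le_iff₀ hlog0]; linarith
  have hG : 1 ≤ Real.Gamma (1 - δ) := one_le_Gamma_of_le_one (by linarith) (by linarith)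
  have hE := exp_neg_one_le
  have hRdef : K * Real.sqrt d / Real.log d = 2 / (Real.pi * Real.exp 1) * Real.sqrt d / Real.log d := by
    rw [hKdef]
  -- lower bound for `R` from `√d ≥ s₀`, `log d ≤ L₀`
  have hRge : ∀ {s₀ L₀ B : ℝ}, 0 ≤ s₀ → s₀ ≤ Real.sqrt d → Real.log d ≤ L₀ → B * L₀ ≤ 0.23419 * s₀ →
      B ≤ K * Real.sqrt d / Real.log d := by
    intro s₀ L₀ B hs₀ hs hL hB
    rw [le_div_iff₀ hlog0]
    have : 0.23419 * s₀ ≤ K * Real.sqrt d := mul_le_mul hK1 hs hs₀ hK0.le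
    have hL0 : Real.log d ≤ L₀ := hL
    by_cases hB0 : 0 ≤ B
    · nlinarith
    · push Not at hB0
      nlinarith
  by_cases h2980 : d ≤ 2980
  · -- band A
    have hlog8 : Real.log d < 8 := by
      rw [Real.log_lt_iff_lt_exp hd0]
      calc (d : ℝ) ≤ 2980 := by exact_mod_cast h2980
        _ < (2.7182818283 : ℝ) ^ 8 := by norm_num
        _ ≤ Real.exp (8 : ℕ) := le_exp_natCast 8
        _ = Real.exp 8 := by norm_num
    have hδ14 : 1 / 4 < δ := by
      rw [hδdef, lt_div_iff₀ hlog0]; linarith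
    have hP : (1.5832 : ℝ) ≤ (2 * Real.pi) ^ δ :=
      rpow_two_pi_quarter_ge.trans (Real.rpow_le_rpow_of_exponent_le h2π1 hδ14.le)
    have hQ : (0.6125 : ℝ) ≤ (2 * Real.pi) ^ (-δ) :=
      rpow_two_pi_neg_four_fifteenths_ge.trans (Real.rpow_le_rpow_of_exponent_le h2π1 (by linarith))
    have hs : (42.53 : ℝ) ≤ Real.sqrt d := Real.le_sqrt_of_sq_le (by
      have : (1809 : ℝ) ≤ d := by exact_mod_cast h1808
      nlinarith)
    have hR : (1.245 : ℝ) ≤ K * Real.sqrt d / Real.log d := hRge (by norm_num) hs hlog8.le (by norm_num)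
    exact (bandA hδ14 hδ415 hP hQ hG hE hR).trans hcf
  by_cases h8103 : d ≤ 8103
  · -- band B
    push Not at h2980
    have hlog8 : (8 : ℝ) ≤ Real.log d := by
      refine le_log_of_exp_le_pow hd0 (k := 8) (m := 1) (by norm_num) (by norm_num) ?_
      calc Real.exp (8 : ℕ) ≤ (2.7182818286 : ℝ) ^ 8 := exp_natCast_le 8
        _ ≤ 2981 := by norm_num
        _ ≤ (d : ℝ) ^ 1 := by rw [pow_one]; exact_mod_cast h2980
    have hlog9 : Real.log d ≤ 9 := by
      rw [Real.log_le_iff_le_exp hd0]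
      calc (d : ℝ) ≤ 8103 := by exact_mod_cast h8103
        _ ≤ (2.7182818283 : ℝ) ^ 9 := by norm_num
        _ ≤ Real.exp (9 : ℕ) := le_exp_natCast 9
        _ = Real.exp 9 := by norm_num
    have hδ14 : δ ≤ 1 / 4 := by
      rw [hδdef, div_le_iff₀ hlog0]; linarith
    have hδ29 : 2 / 9 ≤ δ := by
      rw [hδdef, le_div_iff₀ hlog0]; linarith
    have hP : (1.504 : ℝ) ≤ (2 * Real.pi) ^ δ :=
      rpow_two_pi_two_ninths_ge.trans (Real.rpow_le_rpow_of_exponent_le h2π1 hδ29)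
    have hQ : (0.6316 : ℝ) ≤ (2 * Real.pi) ^ (-δ) :=
      rpow_two_pi_neg_quarter_ge.trans (Real.rpow_le_rpow_of_exponent_le h2π1 (by linarith))
    have hs : (54.59 : ℝ) ≤ Real.sqrt d := Real.le_sqrt_of_sq_le (by
      have : (2981 : ℝ) ≤ d := by exact_mod_cast h2980
      nlinarith)
    have hR : (1.42 : ℝ) ≤ K * Real.sqrt d / Real.log d := hRge (by norm_num) hs hlog9 (by norm_num)
    exact (bandB hδ14 hP hQ hG hE hR).trans hcf
  · -- band C
    push Not at h8103
    have hlog9 : (9 : ℝ) ≤ Real.log d := by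
      refine le_log_of_exp_le_pow hd0 (k := 9) (m := 1) (by norm_num) (by norm_num) ?_
      calc Real.exp (9 : ℕ) ≤ (2.7182818286 : ℝ) ^ 9 := exp_natCast_le 9
        _ ≤ 8104 := by norm_num
        _ ≤ (d : ℝ) ^ 1 := by rw [pow_one]; exact_mod_cast h8103
    have hδ29 : δ ≤ 2 / 9 := by
      rw [hδdef, div_le_iff₀ hlog0]; linarith
    have hP : 1 + 3 / 2 * δ ≤ (2 * Real.pi) ^ δ := by
      rw [Real.rpow_def_of_pos h2π0]
      have h1 := Real.add_one_le_exp (Real.log (2 * Real.pi) * δ)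
      have h2 : 3 / 2 * δ ≤ Real.log (2 * Real.pi) * δ :=
        mul_le_mul_of_nonneg_right three_halves_le_log_two_pi hδ0.le
      linarith
    have hQ : (0.6646 : ℝ) ≤ (2 * Real.pi) ^ (-δ) :=
      rpow_two_pi_neg_two_ninths_ge.trans (Real.rpow_le_rpow_of_exponent_le h2π1 (by linarith))
    have hR : (0 : ℝ) ≤ K * Real.sqrt d / Real.log d := by positivity
    exact (bandC hδ0 hδ29 hP hQ hG hE hR).trans hcf


/-- **Oesterlé's remark (2), p. 59, made explicit**: «Si l'hypothèse de Riemann généralisée était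
démontrée … il résulterait de la proposition que tous les discriminants fondamentaux `−d` pour lesquels
`h(−d) ≤ 30` figurent dans la table de Buell» — Buell's table (Math. Comp. 31 (1977)) covers the
fundamental discriminants `−1 … −4 000 000` (Oesterlé p. 52: «Buell … a publié les valeurs de `h(−d)`
pour `d ≤ 4000000`»; the remark answers, under GRH and with `30` for `10`, the question of p. 53
«tous les discriminants fondamentaux `−d` pour lesquels `h(−d) ≤ 10` figurent dans la table de Buell.
Peut-on le prouver?»). In the form: under the real-zero hypothesis of the
Proposition, `h(−d) ≤ 30` forces `d < 4·10⁶` (for `d ≥ 4·10⁶`,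
`(2/(πe))√d/log d ≥ 0.23419·√d/(13.25 + √d/1000) > 30`, using `log d ≤ log(4·10⁶) + 2(√(d/4·10⁶) − 1)`).
[cite: Oesterle1988Gauss, II §3, remark (2) p. 59] -/
theorem lt_four_million_of_classNumber_le_thirty {d : ℕ} [NeZero d] (hd : 4 < d)
    {χ : DirichletCharacter ℂ d} (hprim : χ.IsPrimitive) (hquad : χ.IsQuadratic) (hodd : χ.Odd)
    (hL : ∀ σ : ℝ, 1 - 2 / Real.log d < σ → σ < 1 → χ.LFunction σ ≠ 0)
    (h30 : classNumber (-(d : ℤ)) ≤ 30) : d < 4000000 := by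
  by_contra hge
  push Not at hge
  have hmain := classNumber_ge_oesterle hd hprim hquad hodd hL
  have h30R : (classNumber (-(d : ℤ)) : ℝ) ≤ 30 := by exact_mod_cast h30
  have hdR : (4000000 : ℝ) ≤ d := by exact_mod_cast hge
  have hd0 : (0 : ℝ) < d := by linarith
  obtain ⟨hK1, -⟩ := two_div_pi_mul_exp_one_bounds
  -- `√d ≥ 2000`
  set u : ℝ := Real.sqrt d with hu
  have hu2000 : (2000 : ℝ) ≤ u := Real.le_sqrt_of_sq_le (by nlinarith)
  have hu0 : 0 < u := by linarith
  have hud : u ^ 2 = d := Real.sq_sqrt hd0.le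
  -- `log d ≤ 13.25 + u/1000`
  have hlog4 : Real.log 4000000 ≤ 15.25 := by
    rw [Real.log_le_iff_le_exp (by norm_num)]
    have h := le_exp_natCast 15
    have h2 : (1.25 : ℝ) ≤ Real.exp 0.25 := by
      have := Real.add_one_le_exp (0.25 : ℝ); norm_num at this ⊢; linarith
    have h3 : Real.exp 15.25 = Real.exp (15 : ℕ) * Real.exp 0.25 := by
      rw [← Real.exp_add]; norm_num
    rw [h3]
    calc (4000000 : ℝ) ≤ (2.7182818283 : ℝ) ^ 15 * 1.25 := by norm_num
      _ ≤ Real.exp (15 : ℕ) * Real.exp 0.25 :=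
          mul_le_mul h h2 (by norm_num) (Real.exp_pos _).le
  have hlogd : Real.log d ≤ 13.25 + u / 1000 := by
    have hsplit : Real.log d = Real.log 4000000 + 2 * Real.log (u / 2000) := by
      rw [← hud, Real.log_div hu0.ne' (by norm_num), show (u : ℝ) ^ 2 = 4000000 * (u / 2000) ^ 2 by ring,
        Real.log_mul (by norm_num) (by positivity), Real.log_pow, Real.log_div hu0.ne' (by norm_num)]
      push_cast
      ring
    have hy : Real.log (u / 2000) ≤ u / 2000 - 1 := Real.log_le_sub_one_of_pos (by positivity)
    rw [hsplit]
    linarith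
  have hlog0 : 0 < Real.log d := Real.log_pos (by linarith)
  -- `R ≥ 0.23419 · u/(13.25 + u/1000) ≥ 0.23419 · 2000/15.25 > 30`
  have hR : 30 < 2 / (Real.pi * Real.exp 1) * u / Real.log d := by
    rw [lt_div_iff₀ hlog0]
    have h1 : 30 * Real.log d ≤ 30 * (13.25 + u / 1000) := by linarith
    have h2 : 0.23419 * u ≤ 2 / (Real.pi * Real.exp 1) * u := mul_le_mul_of_nonneg_right hK1 hu0.le
    nlinarith
  linarith

/-! ## The printed size of the right-hand side of (28) for small `d` -/

/-- **Monotonicity of `√x/log x` past `e²`**: `e² ≤ a ≤ b ⇒ √a/log a ≤ √b/log b`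
(from `log(b/a) ≤ 2(√(b/a) − 1)`). [folklore] -/
private theorem sqrt_div_log_mono {a b : ℝ} (ha : Real.exp 2 ≤ a) (hab : a ≤ b) :
    Real.sqrt a / Real.log a ≤ Real.sqrt b / Real.log b := by
  have ha0 : 0 < a := (Real.exp_pos 2).trans_le ha
  have hb0 : 0 < b := ha0.trans_le hab
  have hla : 2 ≤ Real.log a := (Real.le_log_iff_exp_le ha0).2 ha
  have hlb : Real.log a ≤ Real.log b := Real.log_le_log ha0 hab
  have hla0 : 0 < Real.log a := by linarith
  have hlb0 : 0 < Real.log b := by linarith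
  rw [div_le_div_iff₀ hla0 hlb0]
  have hsa : 0 < Real.sqrt a := Real.sqrt_pos.2 ha0
  have hsb : Real.sqrt a ≤ Real.sqrt b := Real.sqrt_le_sqrt hab
  have hba0 : 0 < b / a := div_pos hb0 ha0
  have hy : Real.log (b / a) ≤ 2 * (Real.sqrt (b / a) - 1) := by
    have h1 := Real.log_le_sub_one_of_pos (Real.sqrt_pos.2 hba0)
    rw [Real.log_sqrt hba0.le] at h1
    linarith
  have hsq : Real.sqrt (b / a) = Real.sqrt b / Real.sqrt a := Real.sqrt_div' b ha0.le
  have hlogb : Real.log b = Real.log a + Real.log (b / a) := by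
    rw [Real.log_div hb0.ne' ha0.ne']; ring
  have hkey : Real.sqrt a * Real.log (b / a) ≤ 2 * (Real.sqrt b - Real.sqrt a) := by
    calc Real.sqrt a * Real.log (b / a) ≤ Real.sqrt a * (2 * (Real.sqrt (b / a) - 1)) :=
          mul_le_mul_of_nonneg_left hy hsa.le
      _ = 2 * (Real.sqrt b - Real.sqrt a) := by rw [hsq]; field_simp
  rw [hlogb, mul_add]
  nlinarith [mul_nonneg (sub_nonneg.2 hsb) (sub_nonneg.2 hla)]

/-- On `e² ≤ d ≤ X` with `y ≤ log X`: `(2/(πe))√d/log d ≤ 0.23421·√X/y`. [folklore] -/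
private theorem oesterleBound_le_of_le {d X y : ℝ} (hd : Real.exp 2 ≤ d) (hdX : d ≤ X) (hy0 : 0 < y)
    (hy : y ≤ Real.log X) :
    2 / (Real.pi * Real.exp 1) * Real.sqrt d / Real.log d ≤ 0.23421 * Real.sqrt X / y := by
  obtain ⟨-, hK2⟩ := two_div_pi_mul_exp_one_bounds
  have hd0 : 0 < d := (Real.exp_pos 2).trans_le hd
  have hld : 2 ≤ Real.log d := (Real.le_log_iff_exp_le hd0).2 hd
  have hmono := sqrt_div_log_mono hd hdX
  have hX : Real.sqrt X / Real.log X ≤ Real.sqrt X / y :=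
    div_le_div_of_nonneg_left (Real.sqrt_nonneg X) hy0 hy
  have hnn : 0 ≤ Real.sqrt d / Real.log d := div_nonneg (Real.sqrt_nonneg d) (by linarith)
  calc 2 / (Real.pi * Real.exp 1) * Real.sqrt d / Real.log d
      = 2 / (Real.pi * Real.exp 1) * (Real.sqrt d / Real.log d) := by ring
    _ ≤ 0.23421 * (Real.sqrt X / y) := mul_le_mul hK2 (hmono.trans hX) hnn (by norm_num)
    _ = 0.23421 * Real.sqrt X / y := by ring

/-- On `3 ≤ d < e²`: `(2/(πe))√d/log d ≤ 0.23421·e/1 < 0.64`. [folklore] -/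
private theorem oesterleBound_le_of_log_lt_two {d : ℝ} (h3 : 3 ≤ d) (hlog : Real.log d < 2) :
    2 / (Real.pi * Real.exp 1) * Real.sqrt d / Real.log d ≤ 0.64 := by
  obtain ⟨-, hK2⟩ := two_div_pi_mul_exp_one_bounds
  have hd0 : 0 < d := by linarith
  have hde : d < Real.exp 2 := (Real.log_lt_iff_lt_exp hd0).1 hlog
  have he2 : Real.exp 2 = Real.exp 1 ^ 2 := by rw [sq, ← Real.exp_add]; norm_num
  have hsd : Real.sqrt d ≤ 2.7182818286 := by
    rw [Real.sqrt_le_left (by norm_num)]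
    rw [he2] at hde
    nlinarith [mul_pos (sub_pos.2 Real.exp_one_lt_d9) (add_pos (Real.exp_pos 1) (by norm_num : (0:ℝ) < 2.7182818286))]
  have hl1 : 1 ≤ Real.log d := by
    rw [Real.le_log_iff_exp_le hd0]
    linarith [Real.exp_one_lt_d9]
  rw [div_le_iff₀ (by linarith)]
  have hK0 : 0 ≤ 2 / (Real.pi * Real.exp 1) := by positivity
  nlinarith [mul_le_mul hK2 hsd (Real.sqrt_nonneg d) (by norm_num), Real.sqrt_nonneg d]

/-- **Oesterlé 1988, p. 58, the sentence after (28), first clause**: «Le second membre de (28) est majoré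
par 1 pour d < 800» — for `3 ≤ d < 800`, `(2/(πe))·√d/log d ≤ 1` (so (28) is automatic below `800`
since `h ≥ 1`; with the next two clauses and the tables `h(−d) = 1 ⇒ d ≤ 163`, `h(−d) = 2 ⇒ d ≤ 427` the
printed proof continues «Il nous suffit donc de démontrer la proposition pour d ≥ 15000»).
[cite: Oesterle1988Gauss, II §3 p. 58 (after (28))] -/
theorem oesterleBound_le_one {d : ℝ} (h3 : 3 ≤ d) (h800 : d < 800) :
    2 / (Real.pi * Real.exp 1) * Real.sqrt d / Real.log d ≤ 1 := by
  rcases lt_or_ge (Real.log d) 2 with hlog | hlog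
  · linarith [oesterleBound_le_of_log_lt_two h3 hlog]
  · have hd0 : 0 < d := by linarith
    have hd : Real.exp 2 ≤ d := (Real.le_log_iff_exp_le hd0).1 hlog
    have hy : (133 / 20 : ℝ) ≤ Real.log 800 := by
      refine le_log_of_exp_le_pow (by norm_num) (k := 133) (m := 20) (by norm_num) (by norm_num) ?_
      calc Real.exp (133 : ℕ) ≤ (2.7182818286 : ℝ) ^ 133 := exp_natCast_le 133
        _ ≤ (800 : ℝ) ^ 20 := by norm_num
    have h := oesterleBound_le_of_le hd h800.le (by norm_num) hy
    have hs : Real.sqrt 800 ≤ 28.2843 := by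
      rw [Real.sqrt_le_left (by norm_num)]; norm_num
    calc 2 / (Real.pi * Real.exp 1) * Real.sqrt d / Real.log d ≤ 0.23421 * Real.sqrt 800 / (133 / 20) := h
      _ ≤ 0.23421 * 28.2843 / (133 / 20) := by gcongr
      _ ≤ 1 := by norm_num

/-- **Oesterlé 1988, p. 58, second clause**: «… par 2 pour d ≤ 5000» — for `3 ≤ d ≤ 5000`,
`(2/(πe))·√d/log d ≤ 2`. [cite: Oesterle1988Gauss, II §3 p. 58 (after (28))] -/
theorem oesterleBound_le_two {d : ℝ} (h3 : 3 ≤ d) (h5000 : d ≤ 5000) :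
    2 / (Real.pi * Real.exp 1) * Real.sqrt d / Real.log d ≤ 2 := by
  rcases lt_or_ge (Real.log d) 2 with hlog | hlog
  · linarith [oesterleBound_le_of_log_lt_two h3 hlog]
  · have hd0 : 0 < d := by linarith
    have hd : Real.exp 2 ≤ d := (Real.le_log_iff_exp_le hd0).1 hlog
    have hy : (17 / 2 : ℝ) ≤ Real.log 5000 := by
      refine le_log_of_exp_le_pow (by norm_num) (k := 17) (m := 2) (by norm_num) (by norm_num) ?_
      calc Real.exp (17 : ℕ) ≤ (2.7182818286 : ℝ) ^ 17 := exp_natCast_le 17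
        _ ≤ (5000 : ℝ) ^ 2 := by norm_num
    have h := oesterleBound_le_of_le hd h5000 (by norm_num) hy
    have hs : Real.sqrt 5000 ≤ 70.711 := by
      rw [Real.sqrt_le_left (by norm_num)]; norm_num
    calc 2 / (Real.pi * Real.exp 1) * Real.sqrt d / Real.log d ≤ 0.23421 * Real.sqrt 5000 / (17 / 2) := h
      _ ≤ 0.23421 * 70.711 / (17 / 2) := by gcongr
      _ ≤ 2 := by norm_num

/-- **Oesterlé 1988, p. 58, third clause**: «… par 3 pour d ≤ 15000» — for `3 ≤ d ≤ 15000`,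
`(2/(πe))·√d/log d ≤ 3`; hence «Il nous suffit donc de démontrer la proposition pour d ≥ 15000»
given the class-number tables. [cite: Oesterle1988Gauss, II §3 p. 58 (after (28))] -/
theorem oesterleBound_le_three {d : ℝ} (h3 : 3 ≤ d) (h15000 : d ≤ 15000) :
    2 / (Real.pi * Real.exp 1) * Real.sqrt d / Real.log d ≤ 3 := by
  rcases lt_or_ge (Real.log d) 2 with hlog | hlog
  · linarith [oesterleBound_le_of_log_lt_two h3 hlog]
  · have hd0 : 0 < d := by linarith
    have hd : Real.exp 2 ≤ d := (Real.le_log_iff_exp_le hd0).1 hlog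
    have hy : (48 / 5 : ℝ) ≤ Real.log 15000 := by
      refine le_log_of_exp_le_pow (by norm_num) (k := 48) (m := 5) (by norm_num) (by norm_num) ?_
      calc Real.exp (48 : ℕ) ≤ (2.7182818286 : ℝ) ^ 48 := exp_natCast_le 48
        _ ≤ (15000 : ℝ) ^ 5 := by norm_num
    have h := oesterleBound_le_of_le hd h15000 (by norm_num) hy
    have hs : Real.sqrt 15000 ≤ 122.475 := by
      rw [Real.sqrt_le_left (by norm_num)]; norm_num
    calc 2 / (Real.pi * Real.exp 1) * Real.sqrt d / Real.log d
        ≤ 0.23421 * Real.sqrt 15000 / (48 / 5) := h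
      _ ≤ 0.23421 * 122.475 / (48 / 5) := by gcongr
      _ ≤ 3 := by norm_num

end Final

end Literature.NumberTheory.QuadraticFields.HeckeLandau
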